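import Literature.NumberTheory.GaloisRepresentations.AbstractClassFieldTheory
import Mathlib.Algebra.BigOperators.Intervals
import Mathlib.Algebra.BigOperators.Fin
import Mathlib.Tactic.Abel
import HarnessLib

/-!
# Abstract class field theory in Weil-group form, part 2: the reciprocity map (Neukirch, *Algebraic Number Theory*, Ch. IV §5)

Continuation of `AbstractClassFieldTheory.lean` (the datum `d : WeilDatum W A`, norms `N_{V|U}`,
valuations `v_U`, Frobenius fields `frobField V σ` = `G_Σ ∩ W`; dictionary `U = G_K ∩ W ⊇ V = G_L ∩ W`).
This file carries out Neukirch's §5 for a datum satisfying the class field axiom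
(`d.IsClassFieldTheory`, (6.1) — only its consequence (6.2) for unramified pairs is used here, exactly
as Neukirch uses (5.1)):

* `frobSum φ n a = ∏_{i<n} φ^i • a` (Neukirch's `a^{φ_n}`) and the norm formula `N_{L|K} = φ_n` for
  unramified `L|K` of degree `n` (`norm_eq_frobSum_of_isUnramified`);
* **Lemma (5.3)** `N_{Σ|K}(a) = N(a)^{φ_n} = N(a^{φ_n})` (`norm_frobField_eq_frobSum_norm`,
  `norm_frobField_eq_norm_frobSum`), `N = N_{L̃|K̃} = norm V (U ⊓ I)`, via `N_{Σ|Σ⁰} = N|_{A_Σ}`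
  (`norm_frobField_frobField`);
* **Lemma (5.4)** (`IsClassFieldTheory.exists_unit_norm_eq_norm_inertia`), for units of `L̃`
  (`IsInfUnit V u`: a unit of some finite subextension of `L̃|K`; Neukirch's "we may assume
  `u, u_i ∈ U_M`, `L ⊆ M`" is realised by enlarging the exponent `n` so that `σ = φⁿ` fixes the data);
* **Definition (5.2)** `recElt U V σ = N_{Σ|K}(π_Σ)` (`π_Σ = primeOf`, a chosen prime), independence
  of the prime modulo `N_{L|K} A_L` (`IsClassFieldTheory.norm_frobField_div_mem`);
* **Proposition (5.5)** multiplicativity (`IsClassFieldTheory.recElt_mul_div_mem`), with Neukirch's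
  `σ₄, τ_i` (in left-action form `τ_i = φ^{n_i} σ_i⁻¹`, `σ₄ = φ^{n₁} σ₂ φ^{-n₁}`, `τ₃ = τ₄ τ₁`);
* **Proposition (5.6)** the reciprocity map `recMap U V : W → A ⧸ normGroup V U`,
  `τ ↦ r̃(σ̃) mod N_{L|K}A_L` for the Frobenius lift `σ̃ = frobLift U V τ` ((4.4)); independence of
  the lift (`IsClassFieldTheory.recMap_eq`, `recMap_congr`), homomorphy (`recMap_mul`), triviality on
  `G_L`, values in `A_K/N_{L|K}A_L` (`recMap_mem_range`);
* **Proposition (5.7)** (unramified case): `r(φ_K) = π_K` (`recMap_frob_eq`), injectivity and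
  surjectivity (`mem_of_recMap_eq_one_of_isUnramified`, `exists_recMap_eq_of_isUnramified`);
* **Proposition (5.8)**, left diagram (norm functoriality, `K ⊆ K'`, `L ⊆ L'`):
  `IsClassFieldTheory.recMap_eq_mk_norm_recElt` and the special cases `K' = K`
  (`recMap_eq_mk_recElt_of_le`, `recMap_eq_map_recMap`).  (The right diagram, conjugation, and
  (5.9), the transfer, are not needed for the reciprocity law and are omitted.)

The general reciprocity law (6.3) for abelian `L|K` follows in `AbstractReciprocityLaw.lean`.

## References

* J. Neukirch, *Algebraic Number Theory*, Grundlehren 322, Springer 1999, Ch. IV §5 ((5.2)–(5.8)),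
  §4 ((4.4)), §6 ((6.2)).  [NeukirchANT1999]
-/

noncomputable section

open scoped Pointwise

namespace Literature.NumberTheory.GaloisRepresentations

namespace AbstractCFT

variable {W : Type*} [Group W] {A : Type*} [CommGroup A] [MulDistribMulAction W A]

namespace WeilDatum

variable (d : WeilDatum W A)

/-! ### Toolkit: norms and the action of normalising elements -/

/-- `τUτ⁻¹ = U` iff `τ` normalises `U`. [folklore] -/
theorem conjSub_eq_self_of_mem_normalizer {U : Subgroup W} {τ : W}
    (hτ : τ ∈ Subgroup.normalizer (U : Set W)) : conjSub τ U = U := by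
  ext ρ
  rw [mem_conjSub_iff]
  rw [Subgroup.mem_normalizer_iff''] at hτ
  exact (hτ ρ).symm

/-- `N_{V|U}(τ • b) = τ • N_{V|U}(b)` when `τ` normalises `U` and `V` (`b ∈ A^{V ∩ U}`).
[cite: NeukirchANT1999, Ch. IV §4, (4.7) (i)] -/
theorem norm_smul_of_mem_normalizer {V U : Subgroup W} [Finite (U ⧸ V.subgroupOf U)] {b : A}
    (hb : b ∈ fixedBy A (V ⊓ U)) {τ : W} (hτU : τ ∈ Subgroup.normalizer (U : Set W))
    (hτV : τ ∈ Subgroup.normalizer (V : Set W)) : norm V U (τ • b) = τ • norm V U b := by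
  have h := norm_conj' hb τ
  rwa [conjSub_eq_self_of_mem_normalizer hτU, conjSub_eq_self_of_mem_normalizer hτV] at h

/-- Elements of `U` normalise `U`. [folklore] -/
theorem mem_normalizer_self {U : Subgroup W} {τ : W} (hτ : τ ∈ U) : τ ∈ Subgroup.normalizer (U : Set W) :=
  Subgroup.le_normalizer hτ

/-- Elements of `U` normalise `U ∩ I`. [folklore] -/
theorem mem_normalizer_inf_inertia {U : Subgroup W} {τ : W} (hτ : τ ∈ Subgroup.normalizer (U : Set W)) :
    τ ∈ Subgroup.normalizer ((U ⊓ d.inertia : Subgroup W) : Set W) := by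
  have := d.zpowers_le_normalizer_inf_inertia hτ
  exact this (Subgroup.mem_zpowers τ)

/-- `K` is its own Frobenius field: `⟨φ_K⟩ · (G_K ∩ I) = G_K`. [cite: NeukirchANT1999, Ch. IV §4] -/
theorem frobField_self {U : Subgroup W} (hU : d.IsField U) {φ : W} (hφU : φ ∈ U) (hφ : d.degZ φ = d.f U) :
    d.frobField U φ = U := by
  apply le_antisymm (d.frobField_le le_rfl hφU)
  intro τ hτ
  rw [d.mem_frobField_iff (mem_normalizer_self hφU)]
  obtain ⟨k, hk⟩ := d.degZ_eq_mul_f hU hτ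
  refine ⟨k, Subgroup.mem_inf.mpr ⟨U.mul_mem (U.inv_mem (U.zpow_mem hφU k)) hτ, ?_⟩⟩
  rw [mem_inertia_iff, degZ_mul, degZ_inv, degZ_zpow, hφ, hk]; ring

/-- An element of `A^{G_K ∩ I}` fixed by the Frobenius `φ_K` lies in `A_K` ("an element of `K̃` fixed
by `φ_K` lies in `K`"). [cite: NeukirchANT1999, Ch. IV §5, proof of (5.4)] -/
theorem mem_fixedBy_of_smul_eq {U : Subgroup W} (hU : d.IsField U) {φ : W} (hφU : φ ∈ U)
    (hφ : d.degZ φ = d.f U) {a : A} (ha : a ∈ fixedBy A (U ⊓ d.inertia)) (hfix : φ • a = a) :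
    a ∈ fixedBy A U := by
  rw [← d.frobField_self hU hφU hφ, d.mem_fixedBy_frobField_iff]
  exact ⟨hfix, ha⟩

/-- **Unit consistency**: for fields `V ≤ U` and `a ∈ A^U`, `a` is a unit of `U` iff it is a unit of
`V` (`v_L = e_{L|K} v_K` on `A_K`). [cite: NeukirchANT1999, Ch. IV §4, (4.7) (ii)] -/
theorem val_eq_zero_iff_of_le {U V : Subgroup W} (hU : d.IsField U) (hV : d.IsField V) (hVU : V ≤ U)
    {a : A} (ha : a ∈ fixedBy A U) : d.val V a = 0 ↔ d.val U a = 0 := by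
  haveI := d.finiteIndex hV
  have h := d.val_norm hU hV hVU (fixedBy_antitone hVU ha)
  rw [norm_eq_pow_of_mem ha, d.val_pow hU ha] at h
  have h1 : ((V.relIndex U : ℕ) : ℤ) ≠ 0 := by
    exact_mod_cast (Subgroup.FiniteIndex.index_ne_zero (H := V.subgroupOf U))
  have h2 : (d.f V / d.f U : ℤ) ≠ 0 := by
    obtain ⟨m, hm⟩ := d.f_dvd_f hU hV hVU
    rw [hm]; push_cast
    rw [Int.mul_ediv_cancel_left _ (d.f_ne_zero hU)]
    intro h0
    have := d.f_pos hV
    rw [hm] at this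
    have hm0 : m = 0 := by exact_mod_cast h0
    rw [hm0, Nat.mul_zero] at this
    exact lt_irrefl 0 this
  constructor
  · intro h0; rw [h0, mul_zero] at h
    rcases mul_eq_zero.mp h with h' | h'
    · exact absurd h' h1
    · exact h'
  · intro h0; rw [h0, mul_zero] at h
    rcases mul_eq_zero.mp h.symm with h' | h'
    · exact absurd h' h2
    · exact h'

/-- Units of `K` are units of every extension `L ⊇ K`. [cite: NeukirchANT1999, Ch. IV §4] -/
theorem unitGroup_le_unitGroup {U V : Subgroup W} (hU : d.IsField U) (hV : d.IsField V) (hVU : V ≤ U) :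
    d.unitGroup U ≤ d.unitGroup V := by
  intro a ha
  obtain ⟨haU, hva⟩ := (d.mem_unitGroup_iff hU).mp ha
  exact (d.mem_unitGroup_iff hV).mpr ⟨fixedBy_antitone hVU haU, (d.val_eq_zero_iff_of_le hU hV hVU haU).mpr hva⟩

/-- Norms of units are units: `N_{L|K} U_L ≤ U_K`. [cite: NeukirchANT1999, Ch. IV §4, (4.7) (ii)] -/
theorem norm_mem_unitGroup {U V : Subgroup W} (hU : d.IsField U) (hV : d.IsField V) (hVU : V ≤ U)
    {b : A} (hb : b ∈ d.unitGroup V) : norm V U b ∈ d.unitGroup U := by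
  haveI := d.finiteIndex hV
  obtain ⟨hbV, hvb⟩ := (d.mem_unitGroup_iff hV).mp hb
  refine (d.mem_unitGroup_iff hU).mpr ⟨norm_mem_fixedBy hbV, ?_⟩
  rw [d.val_norm hU hV hVU hbV, hvb, mul_zero]

/-- Units are stable under the action of normalising elements: `τ • u ∈ U_{τLτ⁻¹} = U_L`. [folklore] -/
theorem smul_mem_unitGroup {V : Subgroup W} (hV : d.IsField V) {τ : W}
    (hτ : τ ∈ Subgroup.normalizer (V : Set W)) {u : A} (hu : u ∈ d.unitGroup V) :
    τ • u ∈ d.unitGroup V := by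
  obtain ⟨huV, hvu⟩ := (d.mem_unitGroup_iff hV).mp hu
  refine (d.mem_unitGroup_iff hV).mpr ⟨?_, ?_⟩
  · have := (smul_mem_fixedBy_conjSub_iff (σ := τ)).mpr huV
    rwa [conjSub_eq_self_of_mem_normalizer hτ] at this
  · have := d.val_conjSub hV huV τ
    rw [conjSub_eq_self_of_mem_normalizer hτ] at this
    rw [this, hvu]

/-- For `V` normal in `U` of finite index `n = (U : V)` and `φ ∈ U`: `φⁿ ∈ V`. [folklore] -/
theorem pow_relIndex_mem {U V : Subgroup W} [V.FiniteIndex] (hVU : V ≤ U)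
    (hUn : U ≤ Subgroup.normalizer (V : Set W)) {φ : W} (hφ : φ ∈ U) : φ ^ V.relIndex U ∈ V := by
  haveI : (V.subgroupOf U).Normal := (Subgroup.normal_subgroupOf_iff_le_normalizer hVU).mpr hUn
  have := Subgroup.pow_index_mem (V.subgroupOf U) ⟨φ, hφ⟩
  rw [Subgroup.mem_subgroupOf, SubgroupClass.coe_pow] at this
  exact this

/-! ### The Frobenius power sums `φ_n` -/

/-- `φ_n(a) = ∏_{i<n} φ^i • a` (Neukirch's `a^{φ_n}`, `φ_n = (φⁿ - 1)/(φ - 1)`).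
[cite: NeukirchANT1999, Ch. IV §5, p. 291] -/
def frobSum (φ : W) (n : ℕ) (a : A) : A := ∏ i ∈ Finset.range n, φ ^ i • a

/-- `φ_n` is multiplicative. [folklore] -/
theorem frobSum_mul (φ : W) (n : ℕ) (a b : A) :
    frobSum φ n (a * b) = frobSum φ n a * frobSum φ n b := by
  simp [frobSum, smul_mul', Finset.prod_mul_distrib]

/-- `φ_n(a⁻¹) = φ_n(a)⁻¹`. [folklore] -/
theorem frobSum_inv (φ : W) (n : ℕ) (a : A) : frobSum φ n a⁻¹ = (frobSum φ n a)⁻¹ := by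
  simp [frobSum, smul_inv', Finset.prod_inv_distrib]

/-- `φ_n(a/b) = φ_n(a)/φ_n(b)`. [folklore] -/
theorem frobSum_div (φ : W) (n : ℕ) (a b : A) : frobSum φ n (a / b) = frobSum φ n a / frobSum φ n b := by
  rw [div_eq_mul_inv, frobSum_mul, frobSum_inv, div_eq_mul_inv]

/-- `(σ - 1) ∘ φ_n`: `φ • φ_n(a) / φ_n(a) = φⁿ • a / a` ("`(φ-1)φ_n = φⁿ - 1`").
[cite: NeukirchANT1999, Ch. IV §5, p. 291] -/
theorem smul_frobSum_div (φ : W) (n : ℕ) (a : A) : φ • frobSum φ n a / frobSum φ n a = φ ^ n • a / a := by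
  induction n with
  | zero => simp [frobSum]
  | succ n ih =>
    have hfs : frobSum φ (n + 1) a = frobSum φ n a * φ ^ n • a := by
      rw [frobSum, Finset.prod_range_succ, ← frobSum]
    rw [hfs, smul_mul', smul_smul, ← pow_succ', mul_div_mul_comm, ih, div_mul_div_comm,
      mul_comm (φ ^ n • a), ← div_mul_div_comm, div_self', mul_one]

/-- `τ • φ_n(a) = φ_n(τ • a)` when `τ` commutes with `φ`. [folklore] -/
theorem smul_frobSum_of_commute {φ τ : W} (h : Commute τ φ) (n : ℕ) (a : A) :
    τ • frobSum φ n a = frobSum φ n (τ • a) := by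
  simp only [frobSum, Finset.smul_prod', smul_smul]
  congr 1; ext i
  rw [(h.pow_right i).eq]

/-- `φ_n` and `ψ_m` commute when `φ` and `ψ` do. [folklore] -/
theorem frobSum_frobSum_comm {φ ψ : W} (h : Commute φ ψ) (n m : ℕ) (a : A) :
    frobSum φ n (frobSum ψ m a) = frobSum ψ m (frobSum φ n a) := by
  simp only [frobSum, Finset.smul_prod', smul_smul]
  rw [Finset.prod_comm]
  congr 1; ext j; congr 1; ext i
  rw [((h.pow_left i).pow_right j).eq]

/-- A map commuting with `φ^i •` and multiplicative commutes with `φ_n`. [folklore] -/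
theorem map_frobSum {N : A → A} (hN1 : N 1 = 1) (hNmul : ∀ a b, N (a * b) = N a * N b) {φ : W} {n : ℕ}
    {a : A} (hcomm : ∀ i < n, N (φ ^ i • a) = φ ^ i • N a) : N (frobSum φ n a) = frobSum φ n (N a) := by
  unfold frobSum
  induction n with
  | zero => simp [hN1]
  | succ n ih =>
    rw [Finset.prod_range_succ, Finset.prod_range_succ, hNmul, ih (fun i hi => hcomm i (by omega)),
      hcomm n (by omega)]

/-- `φ_n(a) ∈ A^X` if all `φ^i • a ∈ A^X`. [folklore] -/
theorem frobSum_mem_fixedBy {X : Subgroup W} {φ : W} {n : ℕ} {a : A}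
    (h : ∀ i < n, φ ^ i • a ∈ fixedBy A X) : frobSum φ n a ∈ fixedBy A X := by
  unfold frobSum
  induction n with
  | zero => simp [(fixedBy A X).one_mem]
  | succ n ih =>
    rw [Finset.prod_range_succ]
    exact (fixedBy A X).mul_mem (ih fun i hi => h i (by omega)) (h n (by omega))

/-- On `A^{⟨φ⟩}`: `φ_n(a) = aⁿ`. [folklore] -/
theorem frobSum_eq_pow_of_smul_eq {φ : W} {a : A} (h : φ • a = a) (n : ℕ) : frobSum φ n a = a ^ n := by
  unfold frobSum
  have : ∀ i : ℕ, φ ^ i • a = a := by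
    intro i; induction i with
    | zero => simp
    | succ i ih => rw [pow_succ, mul_smul, h, ih]
  simp [this, Finset.prod_const]

/-! ### Norms in unramified pairs: `N_{L|K} = φ_n` -/

/-- **Norm formula for an unramified pair**: `N_{V|U}(b) = ∏_{i<n} φ^i • b` for `b ∈ A^V`, where
`n = (U : V)` and `φ` is a Frobenius of `U` ("`N_{Σ⁰|K} = φ_n`", the Galois group being generated by
the Frobenius). [cite: NeukirchANT1999, Ch. IV §5, proof of (5.3)] -/
theorem norm_eq_frobSum_of_isUnramified {U V : Subgroup W} (hU : d.IsField U) (hV : d.IsField V)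
    (hVU : V ≤ U) (hun : d.IsUnramified V U) {φ : W} (hφU : φ ∈ U) (hφ : d.degZ φ = d.f U)
    {b : A} (hb : b ∈ fixedBy A V) : norm V U b = frobSum φ (V.relIndex U) b := by
  classical
  haveI := d.finiteIndex hV
  set n := V.relIndex U with hn
  have hn0 : n ≠ 0 := Subgroup.FiniteIndex.index_ne_zero
  have hnf : (n : ℤ) * d.f U = d.f V := by
    rw [hn, d.relIndex_of_isUnramified hU hV hVU hun]
    obtain ⟨m, hm⟩ := d.f_dvd_f hU hV hVU
    rw [hm, Nat.mul_div_cancel_left _ (d.f_pos hU)]; push_cast; ring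
  -- membership in `V` of powers of `φ`
  have hmemV : ∀ k : ℤ, φ ^ k ∈ V ↔ (n : ℤ) ∣ k := by
    intro k
    rw [d.mem_iff_of_isUnramified hV hVU hun (U.zpow_mem hφU k), degZ_zpow, hφ, ← hnf]
    exact mul_dvd_mul_iff_right (d.f_ne_zero hU)
  -- the bijection `Fin n → U/V`, `i ↦ φ^i V`
  let e : Fin n → U ⧸ V.subgroupOf U := fun i => ((⟨φ ^ (i : ℕ), U.pow_mem hφU _⟩ : U) : U ⧸ V.subgroupOf U)
  have he_eq : ∀ (i : ℕ) (hi : i < n) (k : ℤ), e ⟨i, hi⟩ = ((⟨φ ^ k, U.zpow_mem hφU k⟩ : U) : _) ↔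
      (n : ℤ) ∣ k - i := by
    intro i hi k
    rw [QuotientGroup.eq, Subgroup.mem_subgroupOf, Subgroup.coe_mul, Subgroup.coe_inv]
    change (φ ^ i)⁻¹ * φ ^ k ∈ V ↔ _
    rw [← zpow_natCast, ← zpow_neg, ← zpow_add, hmemV, neg_add_eq_sub]
  have he : Function.Bijective e := by
    constructor
    · rintro ⟨i, hi⟩ ⟨j, hj⟩ h
      have h' := (he_eq i hi j).mp (by rw [h]; simp [e])
      apply Fin.ext
      change i = j
      -- `n ∣ j - i` with `i, j < n`
      rcases h' with ⟨c, hc⟩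
      have : (c : ℤ) = 0 := by
        by_contra hc0
        have : (1 : ℤ) ≤ |c| := Int.one_le_abs hc0
        have h1 : |(j : ℤ) - i| < n := by rw [abs_lt]; constructor <;> omega
        rw [hc, abs_mul, Nat.abs_cast] at h1
        nlinarith
      rw [this, mul_zero, sub_eq_zero] at hc
      omega
    · intro q
      induction q using QuotientGroup.induction_on with | H u => ?_
      obtain ⟨k, hk⟩ := d.exists_zpow_inv_mul_mem_of_isUnramified hU hun hφU hφ u.2
      have hn0' : (n : ℤ) ≠ 0 := by exact_mod_cast hn0
      refine ⟨⟨(k % n).toNat, ?_⟩, ?_⟩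
      · have h1 : k % n < n := Int.emod_lt_of_pos k (by omega)
        have h2 : 0 ≤ k % n := Int.emod_nonneg k hn0'
        omega
      · have h2 : 0 ≤ k % n := Int.emod_nonneg k hn0'
        rw [(he_eq _ _ k).mpr]
        · rw [QuotientGroup.eq, Subgroup.mem_subgroupOf, Subgroup.coe_mul, Subgroup.coe_inv]
          exact hk
        · rw [Int.toNat_of_nonneg h2]
          exact Int.dvd_self_sub_emod
  -- compute the norm with the representatives `φ^i`
  unfold norm
  rw [finprod_eq_of_bijective e he (g := fun q => ((q.out : U) : W) • b) (fun _ => rfl) |>.symm]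
  rw [finprod_eq_prod_of_fintype, frobSum, ← Fin.prod_univ_eq_prod_range]
  refine Finset.prod_congr rfl (fun i _ => ?_)
  -- `(e i).out • b = φ^i • b`
  apply smul_eq_smul_of_mem_fixedBy hb
  have h1 : ((⟨φ ^ (i : ℕ), U.pow_mem hφU _⟩ : U) : U ⧸ V.subgroupOf U) = (((e i).out : U) : _) := by
    rw [QuotientGroup.out_eq']
  have h2 := QuotientGroup.eq.mp h1
  rw [Subgroup.mem_subgroupOf] at h2
  exact h2

/-! ### The Frobenius fields `Σ ⊆ Σ⁰ = Σ ∩ K̃` and Lemma (5.3) -/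

/-- `Σ ⊆ L` when `σ ∈ G_L`: `⟨σ⟩(V ∩ I) ≤ V`. [folklore] -/
theorem frobField_le_of_mem {V : Subgroup W} {σ : W} (hσ : σ ∈ V) : d.frobField V σ ≤ V :=
  d.frobField_le le_rfl hσ

/-- `frobField` is monotone in the group. [folklore] -/
theorem frobField_mono {U V : Subgroup W} (hVU : V ≤ U) (σ : W) : d.frobField V σ ≤ d.frobField U σ :=
  sup_le_sup_left (inf_le_inf_right _ hVU) _

/-- `⟨σⁿ⟩(V ∩ I) ≤ ⟨σ⟩(V ∩ I)` (`Σ ⊆ Σ_n`, the unramified extension inside `L̃`). [folklore] -/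
theorem frobField_pow_le (V : Subgroup W) (σ : W) (n : ℕ) : d.frobField V (σ ^ n) ≤ d.frobField V σ :=
  sup_le ((Subgroup.zpowers_le).mpr ((d.frobField V σ).pow_mem (d.mem_frobField_self V σ) n))
    le_sup_right

/-- `Σ_n | Σ` is unramified: `G_Σ ∩ I ≤ G_{Σ_n}`. [cite: NeukirchANT1999, Ch. IV §5, proof of (5.4)] -/
theorem isUnramified_frobField_pow {V : Subgroup W} {σ : W} (hσ : σ ∈ Subgroup.normalizer (V : Set W))
    (hdeg : d.degZ σ ≠ 0) (n : ℕ) : d.IsUnramified (d.frobField V (σ ^ n)) (d.frobField V σ) := by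
  unfold IsUnramified
  rw [d.frobField_inf_inertia hσ hdeg]
  exact d.inf_inertia_le_frobField V (σ ^ n)

/-- Powers of a normalising element normalise. [folklore] -/
theorem pow_mem_normalizer {V : Subgroup W} {σ : W} (hσ : σ ∈ Subgroup.normalizer (V : Set W)) (n : ℕ) :
    σ ^ n ∈ Subgroup.normalizer (V : Set W) :=
  (Subgroup.normalizer (V : Set W)).pow_mem hσ n

/-- `[Σ_n : Σ] = n`. [cite: NeukirchANT1999, Ch. IV §5, proof of (5.4)] -/
theorem relIndex_frobField_pow {V : Subgroup W} (hV : d.IsField V) {σ : W}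
    (hσ : σ ∈ Subgroup.normalizer (V : Set W)) (hdeg : 0 < d.degZ σ) {n : ℕ} (hn : 0 < n) :
    (d.frobField V (σ ^ n)).relIndex (d.frobField V σ) = n := by
  have hdegn : 0 < d.degZ (σ ^ n) := by rw [degZ_pow]; positivity
  have hS := d.isField_frobField hV hσ hdeg
  have hSn := d.isField_frobField hV (pow_mem_normalizer hσ n) hdegn
  rw [d.relIndex_of_isUnramified hS hSn (d.frobField_pow_le V σ n)
    (d.isUnramified_frobField_pow hσ hdeg.ne' n)]
  have h1 := d.f_frobField hV hσ hdeg
  have h2 := d.f_frobField hV (pow_mem_normalizer hσ n) hdegn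
  rw [degZ_pow, ← h1] at h2
  have h3 : d.f (d.frobField V (σ ^ n)) = n * d.f (d.frobField V σ) := by exact_mod_cast h2
  rw [h3, Nat.mul_div_cancel _ (d.f_pos hS)]

/-- `Σ⁰ = Σ ∩ K̃` is unramified over `K`: `G_K ∩ I ≤ ⟨σ⟩(G_K ∩ I)`. [cite: NeukirchANT1999, Ch. IV §5, (5.3)] -/
theorem isUnramified_frobField_self (U : Subgroup W) (σ : W) : d.IsUnramified (d.frobField U σ) U :=
  le_sup_right

/-- `[Σ⁰ : K] = d_K(σ) = deg σ / f_K`. [cite: NeukirchANT1999, Ch. IV §5, proof of (5.3)] -/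
theorem relIndex_frobField_self {U : Subgroup W} (hU : d.IsField U) {σ : W} (hσ : σ ∈ U) (hdeg : 0 < d.degZ σ) :
    ((d.frobField U σ).relIndex U : ℤ) = d.degZ σ / d.f U := by
  have hσn := mem_normalizer_self hσ
  have hS0 := d.isField_frobField hU hσn hdeg
  rw [d.relIndex_of_isUnramified hU hS0 (d.frobField_le le_rfl hσ) (d.isUnramified_frobField_self U σ)]
  push_cast
  rw [d.f_frobField hU hσn hdeg]

/-- **`N_{Σ|Σ⁰} = N_{L̃|K̃}|_{A_Σ}`**: for `a ∈ A_Σ`, the norm from `Σ` to `Σ⁰ = Σ ∩ K̃` is the norm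
`N = N_{L̃|K̃}` (product over `G(L̃|K̃) = (G_K ∩ I)/(G_L ∩ I)`).
[cite: NeukirchANT1999, Ch. IV §5, proof of (5.3)] -/
theorem norm_frobField_frobField {U V : Subgroup W}
    (hUn : U ≤ Subgroup.normalizer (V : Set W)) {σ : W} (hσ : σ ∈ U) (hdeg : 0 < d.degZ σ) {a : A}
    (ha : a ∈ fixedBy A (d.frobField V σ)) :
    norm (d.frobField V σ) (d.frobField U σ) a = norm V (U ⊓ d.inertia) a := by
  classical
  set S := d.frobField V σ with hS_def
  set S0 := d.frobField U σ with hS0_def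
  have hσV : σ ∈ Subgroup.normalizer (V : Set W) := hUn hσ
  have hσU : σ ∈ Subgroup.normalizer (U : Set W) := mem_normalizer_self hσ
  have hle : U ⊓ d.inertia ≤ S0 := le_sup_right
  have hSI : S ⊓ d.inertia = V ⊓ d.inertia := d.frobField_inf_inertia hσV hdeg.ne'
  -- the bijection `(U ∩ I)/(V ∩ I ∩ ·) → S⁰/S` induced by the inclusion
  let ι : ↥(U ⊓ d.inertia) → ↥S0 := Subgroup.inclusion hle
  have hι : ∀ x, ((ι x : S0) : W) = (x : W) := fun x => rfl
  let e : ↥(U ⊓ d.inertia) ⧸ V.subgroupOf (U ⊓ d.inertia) → S0 ⧸ S.subgroupOf S0 :=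
    Quotient.map' ι (by
      intro x y h
      rw [QuotientGroup.leftRel_apply, Subgroup.mem_subgroupOf] at h ⊢
      rw [Subgroup.coe_mul, Subgroup.coe_inv, hι, hι]
      rw [Subgroup.coe_mul, Subgroup.coe_inv] at h
      apply d.inf_inertia_le_frobField V σ
      refine Subgroup.mem_inf.mpr ⟨h, ?_⟩
      exact (Subgroup.mem_inf.mp ((U ⊓ d.inertia).mul_mem ((U ⊓ d.inertia).inv_mem x.2) y.2)).2)
  have he_mk : ∀ x : ↥(U ⊓ d.inertia), e (x : _ ⧸ _) = ((ι x : S0) : S0 ⧸ S.subgroupOf S0) := fun x => rfl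
  have he : Function.Bijective e := by
    constructor
    · intro q₁ q₂ h
      induction q₁ using QuotientGroup.induction_on with | H x => ?_
      induction q₂ using QuotientGroup.induction_on with | H y => ?_
      rw [he_mk, he_mk] at h
      have h2 := QuotientGroup.eq.mp h
      rw [Subgroup.mem_subgroupOf, Subgroup.coe_mul, Subgroup.coe_inv, hι, hι] at h2
      refine QuotientGroup.eq.mpr ?_
      rw [Subgroup.mem_subgroupOf, Subgroup.coe_mul, Subgroup.coe_inv]
      have hxI : ((x : W))⁻¹ * y ∈ d.inertia :=
        (Subgroup.mem_inf.mp ((U ⊓ d.inertia).mul_mem ((U ⊓ d.inertia).inv_mem x.2) y.2)).2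
      have : ((x : W))⁻¹ * y ∈ S ⊓ d.inertia := Subgroup.mem_inf.mpr ⟨h2, hxI⟩
      rw [hSI] at this
      exact (Subgroup.mem_inf.mp this).1
    · intro q
      induction q using QuotientGroup.induction_on with | H s => ?_
      obtain ⟨s, hs⟩ := s
      obtain ⟨k, hk⟩ := (d.mem_frobField_iff hσU).mp hs
      -- `s = σ^k u`, `u ∈ U ∩ I`; representative `σ^k u σ^{-k} ∈ U ∩ I`
      have hu : σ ^ k * ((σ ^ k)⁻¹ * s) * (σ ^ k)⁻¹ ∈ U ⊓ d.inertia := by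
        have hn := d.mem_normalizer_inf_inertia hσU
        have hn' := (Subgroup.normalizer ((U ⊓ d.inertia : Subgroup W) : Set W)).zpow_mem hn k
        exact (Subgroup.mem_normalizer_iff.mp hn' _).mp hk
      refine ⟨((⟨_, hu⟩ : ↥(U ⊓ d.inertia)) : _ ⧸ _), ?_⟩
      rw [he_mk]
      refine QuotientGroup.eq.mpr ?_
      rw [Subgroup.mem_subgroupOf, Subgroup.coe_mul, Subgroup.coe_inv, hι]
      change (σ ^ k * ((σ ^ k)⁻¹ * s) * (σ ^ k)⁻¹)⁻¹ * s ∈ S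
      have : (σ ^ k * ((σ ^ k)⁻¹ * s) * (σ ^ k)⁻¹)⁻¹ * s = σ ^ k := by group
      rw [this]
      exact S.zpow_mem (d.mem_frobField_self V σ) k
  -- compare the two products
  unfold norm
  refine (finprod_eq_of_bijective e he (fun r => ?_)).symm
  induction r using QuotientGroup.induction_on with | H x => ?_
  -- representatives: `(mk x).out` vs `(e (mk x)).out`, both `≡ x`
  set q : ↥(U ⊓ d.inertia) ⧸ V.subgroupOf (U ⊓ d.inertia) := ↑x with hq
  have h1 : ((q.out : ↥(U ⊓ d.inertia)) : W) • a = (x : W) • a := by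
    apply smul_eq_smul_of_mem_fixedBy ha
    have h3 := mem_inf_of_mem_subgroupOf (QuotientGroup.eq.mp (QuotientGroup.out_eq' q))
    have h3' : ((q.out : ↥(U ⊓ d.inertia)) : W)⁻¹ * x ∈ V ⊓ (U ⊓ d.inertia) := by simpa using h3
    have h4 : ((q.out : ↥(U ⊓ d.inertia)) : W)⁻¹ * x ∈ S := by
      apply d.inf_inertia_le_frobField V σ
      exact Subgroup.mem_inf.mpr ⟨(Subgroup.mem_inf.mp h3').1,
        (Subgroup.mem_inf.mp (Subgroup.mem_inf.mp h3').2).2⟩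
    simpa using S.inv_mem h4
  have h2 : (((e q).out : S0) : W) • a = (x : W) • a := by
    apply smul_eq_smul_of_mem_fixedBy ha
    have h := QuotientGroup.eq.mp ((QuotientGroup.out_eq' (e q)).trans (he_mk x))
    rw [Subgroup.mem_subgroupOf, Subgroup.coe_mul, Subgroup.coe_inv, hι] at h
    have := S.inv_mem h
    simpa using this
  rw [h1, h2]

/-- **Lemma (5.3)**: for `φ, σ ∈ G_K` with `d_K(φ) = 1`, `d_K(σ) = n`, `Σ` the fixed field of `σ`
and `a ∈ A_Σ`: `N_{Σ|K}(a) = (N(a))^{φ_n} = ∏_{i<n} φ^i • N(a)`, `N = N_{L̃|K̃}`, `n = [Σ⁰ : K]`.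
[cite: NeukirchANT1999, Ch. IV §5, Lemma (5.3)] -/
theorem norm_frobField_eq_frobSum_norm {U V : Subgroup W} (hU : d.IsField U) (hV : d.IsField V)
    (hVU : V ≤ U) (hUn : U ≤ Subgroup.normalizer (V : Set W)) {σ : W} (hσ : σ ∈ U) (hdeg : 0 < d.degZ σ)
    {φ : W} (hφU : φ ∈ U) (hφ : d.degZ φ = d.f U) {a : A} (ha : a ∈ fixedBy A (d.frobField V σ)) :
    norm (d.frobField V σ) U a =
      frobSum φ ((d.frobField U σ).relIndex U) (norm V (U ⊓ d.inertia) a) := by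
  haveI := d.finiteIndex hV
  have hσV : σ ∈ Subgroup.normalizer (V : Set W) := hUn hσ
  have hσU : σ ∈ Subgroup.normalizer (U : Set W) := mem_normalizer_self hσ
  have hS := d.isField_frobField hV hσV hdeg
  have hS0 := d.isField_frobField hU hσU hdeg
  haveI := d.finiteIndex hS
  haveI := d.finiteIndex hS0
  have hSS0 : d.frobField V σ ≤ d.frobField U σ := d.frobField_mono hVU σ
  have hS0U : d.frobField U σ ≤ U := d.frobField_le le_rfl hσ
  rw [← norm_norm hSS0 hS0U ha, d.norm_frobField_frobField hUn hσ hdeg ha]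
  apply d.norm_eq_frobSum_of_isUnramified hU hS0 hS0U (d.isUnramified_frobField_self U σ) hφU hφ
  -- `N a ∈ A^{Σ⁰}`: fixed by `σ` and by `U ∩ I`
  rw [d.mem_fixedBy_frobField_iff]
  have ha' : a ∈ fixedBy A (V ⊓ (U ⊓ d.inertia)) :=
    fixedBy_antitone (le_trans (le_inf inf_le_left (inf_le_right.trans inf_le_right))
      (d.inf_inertia_le_frobField V σ)) ha
  constructor
  · rw [← norm_smul_of_mem_normalizer ha' (d.mem_normalizer_inf_inertia hσU) hσV,
      ((d.mem_fixedBy_frobField_iff).mp ha).1]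
  · exact norm_mem_fixedBy' ha'

/-- **Lemma (5.3), second form**: `N_{Σ|K}(a) = N(a^{φ_n}) = N(∏_{i<n} φ^i • a)`.
[cite: NeukirchANT1999, Ch. IV §5, Lemma (5.3)] -/
theorem norm_frobField_eq_norm_frobSum {U V : Subgroup W} (hU : d.IsField U) (hV : d.IsField V)
    (hVU : V ≤ U) (hUn : U ≤ Subgroup.normalizer (V : Set W)) {σ : W} (hσ : σ ∈ U) (hdeg : 0 < d.degZ σ)
    {φ : W} (hφU : φ ∈ U) (hφ : d.degZ φ = d.f U) {a : A} (ha : a ∈ fixedBy A (d.frobField V σ)) :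
    norm (d.frobField V σ) U a =
      norm V (U ⊓ d.inertia) (frobSum φ ((d.frobField U σ).relIndex U) a) := by
  haveI := d.finiteIndex hV
  rw [d.norm_frobField_eq_frobSum_norm hU hV hVU hUn hσ hdeg hφU hφ ha]
  have ha' : a ∈ fixedBy A (V ⊓ (U ⊓ d.inertia)) :=
    fixedBy_antitone (le_trans (le_inf inf_le_left (inf_le_right.trans inf_le_right))
      (d.inf_inertia_le_frobField V σ)) ha
  symm
  apply map_frobSum (norm_one _ _) (norm_mul _ _)
  intro i _
  have hφi : φ ^ i ∈ U := U.pow_mem hφU i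
  exact norm_smul_of_mem_normalizer ha' (d.mem_normalizer_inf_inertia (mem_normalizer_self hφi))
    (hUn hφi)

/-! ### Lemma (5.4) -/

/-- `τ • a ∈ A^X` for `a ∈ A^X` and `τ` normalising `X`. [folklore] -/
theorem smul_mem_fixedBy_of_mem_normalizer {X : Subgroup W} {τ : W}
    (hτ : τ ∈ Subgroup.normalizer (X : Set W)) {a : A} (ha : a ∈ fixedBy A X) : τ • a ∈ fixedBy A X := by
  have := (smul_mem_fixedBy_conjSub_iff (σ := τ)).mpr ha
  rwa [conjSub_eq_self_of_mem_normalizer hτ] at this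

/-- If `σ ∈ G_L` (`V`), then `G_K` normalises `G_Σ = ⟨σ⟩(G_L ∩ I)` ("`Σ|K` is Galois when
`Σ ⊇ L`", used for `σ = φ_K^{[L:K]}`). [cite: NeukirchANT1999, Ch. IV §5, proof of (5.4)] -/
theorem conj_mem_frobField_of_mem {U V : Subgroup W} (hUn : U ≤ Subgroup.normalizer (V : Set W))
    {σ : W} (hσV : σ ∈ V) {τ : W} (hτ : τ ∈ U) {x : W} (hx : x ∈ d.frobField V σ) :
    τ * x * τ⁻¹ ∈ d.frobField V σ := by
  have hσn : σ ∈ Subgroup.normalizer (V : Set W) := Subgroup.le_normalizer hσV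
  have hτn : τ ∈ Subgroup.normalizer (V : Set W) := hUn hτ
  obtain ⟨k, hk⟩ := (d.mem_frobField_iff hσn).mp hx
  have h1 : τ * ((σ ^ k)⁻¹ * x) * τ⁻¹ ∈ V ⊓ d.inertia :=
    (Subgroup.mem_normalizer_iff.mp (d.mem_normalizer_inf_inertia hτn) _).mp hk
  have h2 : τ * σ ^ k * τ⁻¹ * (σ ^ k)⁻¹ ∈ V ⊓ d.inertia := by
    refine Subgroup.mem_inf.mpr ⟨?_, ?_⟩
    · exact V.mul_mem ((Subgroup.mem_normalizer_iff.mp hτn _).mp (V.zpow_mem hσV k))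
        (V.inv_mem (V.zpow_mem hσV k))
    · rw [mem_inertia_iff]; simp
  have : τ * x * τ⁻¹ = (τ * σ ^ k * τ⁻¹ * (σ ^ k)⁻¹) * σ ^ k * (τ * ((σ ^ k)⁻¹ * x) * τ⁻¹) := by group
  rw [this]
  refine (d.frobField V σ).mul_mem ((d.frobField V σ).mul_mem (d.inf_inertia_le_frobField V σ h2)
    ((d.frobField V σ).zpow_mem (d.mem_frobField_self V σ) k)) (d.inf_inertia_le_frobField V σ h1)

/-- If `σ ∈ G_L`, then `G_K ≤ N(G_Σ)`. [cite: NeukirchANT1999, Ch. IV §5, proof of (5.4)] -/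
theorem le_normalizer_frobField_of_mem {U V : Subgroup W} (hUn : U ≤ Subgroup.normalizer (V : Set W))
    {σ : W} (hσV : σ ∈ V) : U ≤ Subgroup.normalizer ((d.frobField V σ : Subgroup W) : Set W) := by
  intro τ hτ
  rw [Subgroup.mem_normalizer_iff]
  intro x
  constructor
  · exact d.conj_mem_frobField_of_mem hUn hσV hτ
  · intro h
    have := d.conj_mem_frobField_of_mem hUn hσV (U.inv_mem hτ) h
    simpa [mul_assoc] using this

/-- Products of units are units. [folklore] -/
theorem frobSum_mem_unitGroup {X : Subgroup W} (hX : d.IsField X) {φ : W}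
    (hφ : φ ∈ Subgroup.normalizer (X : Set W)) (n : ℕ) {a : A} (ha : a ∈ d.unitGroup X) :
    frobSum φ n a ∈ d.unitGroup X := by
  unfold frobSum
  refine Subgroup.prod_mem _ (fun i _ => ?_)
  exact d.smul_mem_unitGroup hX (pow_mem_normalizer hφ i) ha

/-! ### Units of `L̃` -/

/-- `u ∈ U_{L̃}`: `u` is a unit of some finite extension `M` of `K` inside `L̃` (`V ∩ I ≤ M`).
[cite: NeukirchANT1999, Ch. IV §5, (5.4)] -/
def IsInfUnit (V : Subgroup W) (u : A) : Prop :=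
  ∃ M : Subgroup W, d.IsField M ∧ V ⊓ d.inertia ≤ M ∧ u ∈ d.unitGroup M

variable {d} in
/-- A unit of `L̃` lies in `A_{L̃} = A^{V ∩ I}`. [folklore] -/
theorem IsInfUnit.mem_fixedBy {V : Subgroup W} {u : A} (h : d.IsInfUnit V u) : u ∈ fixedBy A (V ⊓ d.inertia) := by
  obtain ⟨M, hM, hle, hu⟩ := h
  exact fixedBy_antitone hle (d.unitGroup_le_fixedBy hM hu)

variable {d} in
/-- A unit of `L̃` lying in `A_S` (any field `S`) is a unit of `S` (`v_{M∩S} = e v_M = e' v_S`).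
[cite: NeukirchANT1999, Ch. IV §4, (4.7) (ii)] -/
theorem IsInfUnit.mem_unitGroup {V S : Subgroup W} {u : A} (h : d.IsInfUnit V u) (hS : d.IsField S)
    (huS : u ∈ fixedBy A S) : u ∈ d.unitGroup S := by
  obtain ⟨M, hM, -, hu⟩ := h
  obtain ⟨huM, hvM⟩ := (d.mem_unitGroup_iff hM).mp hu
  have hMS := d.isField_inf hM hS
  have h1 : d.val (M ⊓ S) u = 0 := (d.val_eq_zero_iff_of_le hM hMS inf_le_left huM).mpr hvM
  exact (d.mem_unitGroup_iff hS).mpr ⟨huS, (d.val_eq_zero_iff_of_le hS hMS inf_le_right huS).mp h1⟩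

variable {d} in
/-- Units of a field `M ⊇ L̃`-level are units of `L̃`. [folklore] -/
theorem isInfUnit_of_mem_unitGroup {V M : Subgroup W} (hM : d.IsField M) (hle : V ⊓ d.inertia ≤ M) {u : A}
    (hu : u ∈ d.unitGroup M) : d.IsInfUnit V u :=
  ⟨M, hM, hle, hu⟩

variable {d} in
/-- `U_{L̃}` is closed under products. [folklore] -/
theorem IsInfUnit.mul {V : Subgroup W} {u u' : A} (h : d.IsInfUnit V u) (h' : d.IsInfUnit V u') :
    d.IsInfUnit V (u * u') := by
  obtain ⟨M, hM, hle, hu⟩ := h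
  obtain ⟨M', hM', hle', hu'⟩ := h'
  refine ⟨M ⊓ M', d.isField_inf hM hM', le_inf hle hle', (d.unitGroup (M ⊓ M')).mul_mem ?_ ?_⟩
  · exact d.unitGroup_le_unitGroup hM (d.isField_inf hM hM') inf_le_left hu
  · exact d.unitGroup_le_unitGroup hM' (d.isField_inf hM hM') inf_le_right hu'

variable {d} in
/-- `U_{L̃}` is closed under inverses. [folklore] -/
theorem IsInfUnit.inv {V : Subgroup W} {u : A} (h : d.IsInfUnit V u) : d.IsInfUnit V u⁻¹ := by
  obtain ⟨M, hM, hle, hu⟩ := h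
  exact ⟨M, hM, hle, (d.unitGroup M).inv_mem hu⟩

variable {d} in
/-- `U_{L̃}` is closed under quotients. [folklore] -/
theorem IsInfUnit.div {V : Subgroup W} {u u' : A} (h : d.IsInfUnit V u) (h' : d.IsInfUnit V u') :
    d.IsInfUnit V (u / u') := by
  rw [div_eq_mul_inv]; exact h.mul h'.inv

variable {d} in
/-- `U_{L̃}` is stable under `G_K` (`U` normalising `V`). [folklore] -/
theorem IsInfUnit.smul {U V : Subgroup W} (hUn : U ≤ Subgroup.normalizer (V : Set W)) {u : A}
    (h : d.IsInfUnit V u) {τ : W} (hτ : τ ∈ U) : d.IsInfUnit V (τ • u) := by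
  obtain ⟨M, hM, hle, hu⟩ := h
  refine ⟨conjSub τ M, d.isField_conjSub hM τ, ?_, ?_⟩
  · have h1 : conjSub τ (V ⊓ d.inertia) = V ⊓ d.inertia :=
      conjSub_eq_self_of_mem_normalizer (d.mem_normalizer_inf_inertia (hUn hτ))
    rw [← h1]; exact conjSub_mono hle
  · obtain ⟨huM, hvM⟩ := (d.mem_unitGroup_iff hM).mp hu
    refine (d.mem_unitGroup_iff (d.isField_conjSub hM τ)).mpr ⟨?_, ?_⟩
    · exact (smul_mem_fixedBy_conjSub_iff (σ := τ)).mpr huM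
    · rw [d.val_conjSub hM huM τ, hvM]

include d in
/-- Some positive power of any `φ` fixes a given element (stabilisers are fields, of finite index).
[folklore] -/
theorem exists_pow_smul_eq (φ : W) (a : A) : ∃ k : ℕ, 0 < k ∧ φ ^ k • a = a := by
  haveI := d.finiteIndex (d.isField_stabilizer a)
  obtain ⟨k, hk, -, hmem⟩ := Subgroup.exists_pow_mem_of_index_ne_zero
    (Subgroup.FiniteIndex.index_ne_zero (H := MulAction.stabilizer W a)) φ
  exact ⟨k, hk, hmem⟩

omit [CommGroup A] [MulDistribMulAction W A] in
/-- If `φᵏ` fixes `a` then so does `φ^{k j}`. [folklore] -/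
theorem smul_eq_of_pow_smul_eq [MulAction W A] {φ : W} {k : ℕ} {a : A} (h : φ ^ k • a = a) (j : ℕ) :
    (φ ^ k) ^ j • a = a := by
  induction j with
  | zero => simp
  | succ j ih => rw [pow_succ, mul_smul, h, ih]

include d in
/-- A common positive power of `φ` fixing `u` and finitely many `uu i`. [folklore] -/
theorem exists_pow_smul_eq_finset (φ : W) (u : A) {ι : Type*} (s : Finset ι) (uu : ι → A) :
    ∃ k : ℕ, 0 < k ∧ φ ^ k • u = u ∧ ∀ i ∈ s, φ ^ k • uu i = uu i := by
  classical
  induction s using Finset.induction_on with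
  | empty =>
    obtain ⟨k, hk, h⟩ := d.exists_pow_smul_eq φ u
    exact ⟨k, hk, h, fun i hi => absurd hi (Finset.notMem_empty i)⟩
  | insert a s ha ih =>
    obtain ⟨k, hk, hku, hks⟩ := ih
    obtain ⟨k', hk', hka⟩ := d.exists_pow_smul_eq φ (uu a)
    refine ⟨k * k', Nat.mul_pos hk hk', ?_, ?_⟩
    · rw [pow_mul]; exact smul_eq_of_pow_smul_eq hku k'
    · intro i hi
      rcases Finset.mem_insert.mp hi with rfl | hi
      · rw [mul_comm, pow_mul]; exact smul_eq_of_pow_smul_eq hka k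
      · rw [pow_mul]; exact smul_eq_of_pow_smul_eq (hks i hi) k'

variable {d} in
/-- **Lemma (5.4)** (Weil form).  Let `L|K` be Galois (`V ≤ U` fields, `V` normal in `U`), `φ ∈ G_K`
with `d_K(φ) = 1`, `N = N_{L̃|K̃}` (`norm V (U ⊓ I)`).  If `u ∈ U_{L̃}` (a unit of some finite
subextension of `L̃`, `IsInfUnit`) satisfies `u^{φ-1} = ∏ᵢ u_i^{τ_i - 1}` with `u_i ∈ U_{L̃}`,
`τ_i ∈ G(L̃|K̃)` (`U ∩ I`) — i.e. the class of `u` in `H₀(G(L̃|K̃), U_{L̃})` is fixed by `φ` — then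
`N(u) ∈ N_{L|K} U_L` (Neukirch: `N(u) ∈ N_{M|K} U_M` for all finite Galois `M|K` inside `L̃`, "we may
assume `u, u_i ∈ U_M` and `L ⊆ M`"; here `M = L`, and the reduction to `σ = φⁿ` fixing the data
is done by enlarging `n` to a multiple of `[L:K]`).
[cite: NeukirchANT1999, Ch. IV §5, Lemma (5.4)] -/
theorem IsClassFieldTheory.exists_unit_norm_eq_norm_inertia (hcf : d.IsClassFieldTheory) {U V : Subgroup W}
    (hU : d.IsField U) (hV : d.IsField V) (hVU : V ≤ U) (hUn : U ≤ Subgroup.normalizer (V : Set W))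
    {φ : W} (hφU : φ ∈ U) (hφ : d.degZ φ = d.f U)
    {u : A} (hu : d.IsInfUnit V u) {ι : Type*} {s : Finset ι} {uu : ι → A} {τ : ι → W}
    (huu : ∀ i ∈ s, d.IsInfUnit V (uu i)) (hτ : ∀ i ∈ s, τ i ∈ U ⊓ d.inertia)
    (hrel : φ • u / u = ∏ i ∈ s, τ i • uu i / uu i) :
    ∃ w ∈ d.unitGroup V, norm V U w = norm V (U ⊓ d.inertia) u := by
  classical
  haveI := d.finiteIndex hU
  haveI := d.finiteIndex hV
  -- `n = [L : K] · k` with `σ = φⁿ ∈ G_L` fixing `u` and the `u_i`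
  obtain ⟨k, hkpos, hku, hkuu⟩ := d.exists_pow_smul_eq_finset φ u s uu
  set n := V.relIndex U * k with hn_def
  have hidx_ne : V.relIndex U ≠ 0 := Subgroup.FiniteIndex.index_ne_zero
  have hnpos : 0 < n := Nat.mul_pos (Nat.pos_of_ne_zero hidx_ne) hkpos
  have hn0 : n ≠ 0 := hnpos.ne'
  set σ := φ ^ n with hσ_def
  have hσV : σ ∈ V := by
    rw [hσ_def, hn_def, pow_mul]
    exact V.pow_mem (pow_relIndex_mem hVU hUn hφU) k
  have hσu : σ • u = u := by rw [hσ_def, hn_def, mul_comm, pow_mul]; exact smul_eq_of_pow_smul_eq hku _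
  have hσuu : ∀ i ∈ s, σ • uu i = uu i := fun i hi => by
    rw [hσ_def, hn_def, mul_comm, pow_mul]; exact smul_eq_of_pow_smul_eq (hkuu i hi) _
  have hσU : σ ∈ U := hVU hσV
  have hfU := d.f_pos hU
  have hdegσ : d.degZ σ = n * d.f U := by rw [hσ_def, degZ_pow, hφ]
  have hdegσ_pos : 0 < d.degZ σ := by rw [hdegσ]; positivity
  have hσn : σ ∈ Subgroup.normalizer (V : Set W) := hUn hσU
  -- `Σ`, with `L ⊆ Σ`, Galois over `K`
  set S := d.frobField V σ with hS_def
  have hS : d.IsField S := d.isField_frobField hV hσn hdegσ_pos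
  haveI := d.finiteIndex hS
  have hSV : S ≤ V := d.frobField_le_of_mem hσV
  have hSU : S ≤ U := hSV.trans hVU
  have hUS : U ≤ Subgroup.normalizer (S : Set W) := d.le_normalizer_frobField_of_mem hUn hσV
  have hfS : d.degZ σ = d.f S := (d.f_frobField hV hσn hdegσ_pos).symm
  have hσS : σ ∈ S := d.mem_frobField_self V σ
  -- `Σ_n`, the unramified extension of degree `n` of `Σ` inside `L̃`
  set Sn := d.frobField V (σ ^ n) with hSn_def
  have hdegσn_pos : 0 < d.degZ (σ ^ n) := by rw [degZ_pow]; positivity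
  have hσnV : σ ^ n ∈ V := V.pow_mem hσV n
  have hσnn : σ ^ n ∈ Subgroup.normalizer (V : Set W) := hUn (hVU hσnV)
  have hSn : d.IsField Sn := d.isField_frobField hV hσnn hdegσn_pos
  haveI := d.finiteIndex hSn
  have hSnS : Sn ≤ S := d.frobField_pow_le V σ n
  have hUSn : U ≤ Subgroup.normalizer (Sn : Set W) := d.le_normalizer_frobField_of_mem hUn hσnV
  have hunr : d.IsUnramified Sn S := d.isUnramified_frobField_pow hσn hdegσ_pos.ne' n
  have hidx : Sn.relIndex S = n := d.relIndex_frobField_pow hV hσn hdegσ_pos hnpos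
  have hle0 : V ⊓ (U ⊓ d.inertia) ≤ Sn :=
    le_trans (le_inf inf_le_left (inf_le_right.trans inf_le_right)) (d.inf_inertia_le_frobField V _)
  -- units of `L̃` fixed by `σ` are units of `Σ`; lift them to units of `Σ_n` by (6.2)
  have huS : u ∈ d.unitGroup S :=
    hu.mem_unitGroup hS ((d.mem_fixedBy_frobField_iff).mpr ⟨hσu, hu.mem_fixedBy⟩)
  have huuS : ∀ i ∈ s, uu i ∈ d.unitGroup S := fun i hi =>
    (huu i hi).mem_unitGroup hS ((d.mem_fixedBy_frobField_iff).mpr ⟨hσuu i hi, (huu i hi).mem_fixedBy⟩)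
  obtain ⟨ut, hut, hNut⟩ := hcf.exists_unit_norm_eq hS hSn hSnS hunr huS
  choose! uut huut hNuut using fun i (hi : i ∈ s) => hcf.exists_unit_norm_eq hS hSn hSnS hunr (huuS i hi)
  have hut_fix : ut ∈ fixedBy A Sn := ((d.mem_unitGroup_iff hSn).mp hut).1
  have huut_fix : ∀ i ∈ s, uut i ∈ fixedBy A Sn := fun i hi => ((d.mem_unitGroup_iff hSn).mp (huut i hi)).1
  have hτU : ∀ i ∈ s, τ i ∈ U := fun i hi => (Subgroup.mem_inf.mp (hτ i hi)).1
  -- `X = ut^{φ-1}`, `Y = ∏ uut_i^{τ_i - 1}`: units of `Σ_n` with the same norm to `Σ`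
  set X := φ • ut / ut with hX_def
  set Y := ∏ i ∈ s, τ i • uut i / uut i with hY_def
  have hXu : X ∈ d.unitGroup Sn :=
    (d.unitGroup Sn).div_mem (d.smul_mem_unitGroup hSn (hUSn hφU) hut) hut
  have hYu : Y ∈ d.unitGroup Sn := by
    refine Subgroup.prod_mem _ (fun i hi => ?_)
    exact (d.unitGroup Sn).div_mem (d.smul_mem_unitGroup hSn (hUSn (hτU i hi)) (huut i hi)) (huut i hi)
  have hNX : norm Sn S X = φ • u / u := by
    rw [hX_def, norm_div, norm_smul_of_mem_normalizer (fixedBy_antitone inf_le_left hut_fix) (hUS hφU)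
      (hUSn hφU), hNut]
  have hNY : norm Sn S Y = ∏ i ∈ s, τ i • uu i / uu i := by
    rw [hY_def, ← normHom_apply, map_prod]
    refine Finset.prod_congr rfl (fun i hi => ?_)
    rw [normHom_apply, norm_div, norm_smul_of_mem_normalizer (fixedBy_antitone inf_le_left (huut_fix i hi))
      (hUS (hτU i hi)) (hUSn (hτU i hi)), hNuut i hi]
  have h1 : norm Sn S (X / Y) = 1 := by rw [norm_div, hNX, hNY, hrel, div_self']
  -- by (6.2) (`H⁻¹`), `X / Y = yt^{σ - 1}` with `yt` a unit of `Σ_n`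
  obtain ⟨yt, hyt, hXY⟩ := hcf.exists_unit_eq_smul_div hS hSn hSnS hunr hσS hfS
    ((d.unitGroup Sn).div_mem hXu hYu) h1
  have hyt_fix : yt ∈ fixedBy A Sn := ((d.mem_unitGroup_iff hSn).mp hyt).1
  -- `z = yt^{φ_n}`: `σ • yt / yt = φ • z / z`
  set z := frobSum φ n yt with hz_def
  have hz : σ • yt / yt = φ • z / z := by rw [hz_def, smul_frobSum_div]
  have hz_unit : z ∈ d.unitGroup Sn := d.frobSum_mem_unitGroup hSn (hUSn hφU) n hyt
  have hz_fix : z ∈ fixedBy A Sn := ((d.mem_unitGroup_iff hSn).mp hz_unit).1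
  have heqA : φ • ut / ut = φ • z / z * Y := by
    rw [← hz, ← hXY, div_mul_cancel]
  -- apply `N = N_{L̃|K̃}`
  have hNφ : ∀ b ∈ fixedBy A (V ⊓ (U ⊓ d.inertia)), norm V (U ⊓ d.inertia) (φ • b) = φ • norm V (U ⊓ d.inertia) b :=
    fun b hb => norm_smul_of_mem_normalizer hb (d.mem_normalizer_inf_inertia (mem_normalizer_self hφU)) (hUn hφU)
  have hNτ : ∀ i ∈ s, ∀ b ∈ fixedBy A (V ⊓ (U ⊓ d.inertia)),
      norm V (U ⊓ d.inertia) (τ i • b) = norm V (U ⊓ d.inertia) b := by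
    intro i hi b hb
    rw [norm_smul_of_mem_normalizer hb (d.mem_normalizer_inf_inertia (mem_normalizer_self (hτU i hi)))
      (hUn (hτU i hi)), smul_norm_of_mem' hb (hτ i hi)]
  have hNY1 : norm V (U ⊓ d.inertia) Y = 1 := by
    rw [hY_def, ← normHom_apply, map_prod]
    refine Finset.prod_eq_one (fun i hi => ?_)
    rw [normHom_apply, norm_div, hNτ i hi _ (fixedBy_antitone hle0 (huut_fix i hi)), div_self']
  have heqB : φ • norm V (U ⊓ d.inertia) ut / norm V (U ⊓ d.inertia) ut =
      φ • norm V (U ⊓ d.inertia) z / norm V (U ⊓ d.inertia) z := by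
    have := congrArg (norm V (U ⊓ d.inertia)) heqA
    rwa [norm_div, norm_mul, norm_div, hNφ _ (fixedBy_antitone hle0 hut_fix),
      hNφ _ (fixedBy_antitone hle0 hz_fix), hNY1, mul_one] at this
  -- `w = N(ut)/N(z)` is fixed by `φ`, hence lies in `A_K`, and is a unit
  set w := norm V (U ⊓ d.inertia) ut / norm V (U ⊓ d.inertia) z with hw_def
  have hw_fix : φ • w = w := by
    rw [hw_def, smul_div', div_eq_div_iff_mul_eq_mul]
    rw [div_eq_div_iff_mul_eq_mul] at heqB
    rw [mul_comm] at heqB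
    -- heqB : N z * φ • N ut = φ • N z * N ut  (after rearrangement)
    calc φ • norm V (U ⊓ d.inertia) ut * norm V (U ⊓ d.inertia) z
        = norm V (U ⊓ d.inertia) z * φ • norm V (U ⊓ d.inertia) ut := mul_comm _ _
      _ = φ • norm V (U ⊓ d.inertia) z * norm V (U ⊓ d.inertia) ut := heqB
      _ = norm V (U ⊓ d.inertia) ut * φ • norm V (U ⊓ d.inertia) z := mul_comm _ _
  have hwUI : w ∈ fixedBy A (U ⊓ d.inertia) :=
    (fixedBy A _).div_mem (norm_mem_fixedBy' (fixedBy_antitone hle0 hut_fix))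
      (norm_mem_fixedBy' (fixedBy_antitone hle0 hz_fix))
  have hwU : w ∈ fixedBy A U := d.mem_fixedBy_of_smul_eq hU hφU hφ hwUI hw_fix
  -- unit: `N = N_{Σ_n | Σ_n⁰}` on `A_{Σ_n}`, and norms of units are units
  set Sn0 := d.frobField U (σ ^ n) with hSn0_def
  have hσnU : σ ^ n ∈ U := U.pow_mem hσU n
  have hSn0 : d.IsField Sn0 := d.isField_frobField hU (mem_normalizer_self hσnU) hdegσn_pos
  have hSnSn0 : Sn ≤ Sn0 := d.frobField_mono hVU _
  have hSn0U : Sn0 ≤ U := d.frobField_le le_rfl hσnU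
  have hNeq : ∀ b ∈ fixedBy A Sn, norm V (U ⊓ d.inertia) b = norm Sn Sn0 b :=
    fun b hb => (d.norm_frobField_frobField hUn hσnU hdegσn_pos hb).symm
  have hw_unit0 : w ∈ d.unitGroup Sn0 := by
    rw [hw_def, hNeq _ hut_fix, hNeq _ hz_fix]
    exact (d.unitGroup Sn0).div_mem (d.norm_mem_unitGroup hSn0 hSn hSnSn0 hut)
      (d.norm_mem_unitGroup hSn0 hSn hSnSn0 hz_unit)
  have hw_unitU : w ∈ d.unitGroup U :=
    (d.mem_unitGroup_iff hU).mpr ⟨hwU, (d.val_eq_zero_iff_of_le hU hSn0 hSn0U hwU).mp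
      ((d.mem_unitGroup_iff hSn0).mp hw_unit0).2⟩
  -- `y = N_{Σ_n|Σ}(yt) = yt^{σ_n}`, a unit of `Σ`
  set y := frobSum σ n yt with hy_def
  have hy_eq : norm Sn S yt = y := by
    rw [hy_def, d.norm_eq_frobSum_of_isUnramified hS hSn hSnS hunr hσS hfS hyt_fix, hidx]
  have hy_unit : y ∈ d.unitGroup S := hy_eq ▸ d.norm_mem_unitGroup hS hSn hSnS hyt
  have hyS : y ∈ fixedBy A S := ((d.mem_unitGroup_iff hS).mp hy_unit).1
  -- the final computation `N(u) = wⁿ · N_{Σ|K}(y) = N_{L|K}(w · N_{Σ|L}(y))`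
  have hcommσ : ∀ (b : A), b ∈ fixedBy A (V ⊓ (U ⊓ d.inertia)) → ∀ j : ℕ,
      norm V (U ⊓ d.inertia) (σ ^ j • b) = σ ^ j • norm V (U ⊓ d.inertia) b := by
    intro b hb j
    have hσj : σ ^ j ∈ U := U.pow_mem hσU j
    exact norm_smul_of_mem_normalizer hb (d.mem_normalizer_inf_inertia (mem_normalizer_self hσj)) (hUn hσj)
  have hidx0 : (d.frobField U σ).relIndex U = n := by
    have := d.relIndex_frobField_self hU hσU hdegσ_pos
    rw [hdegσ, Int.mul_ediv_cancel _ (d.f_ne_zero hU)] at this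
    exact_mod_cast this
  have hNu : norm V (U ⊓ d.inertia) u = w ^ n * norm S U y := by
    have hzz : frobSum φ n (frobSum σ n yt) = frobSum φ n y := by rw [hy_def]
    calc norm V (U ⊓ d.inertia) u
        = norm V (U ⊓ d.inertia) (frobSum σ n ut) := by
          rw [← hNut, d.norm_eq_frobSum_of_isUnramified hS hSn hSnS hunr hσS hfS hut_fix, hidx]
      _ = frobSum σ n (norm V (U ⊓ d.inertia) ut) :=
          map_frobSum (norm_one _ _) (norm_mul _ _) (fun j _ => hcommσ _ (fixedBy_antitone hle0 hut_fix) j)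
      _ = frobSum σ n (w * norm V (U ⊓ d.inertia) z) := by rw [hw_def, div_mul_cancel]
      _ = w ^ n * frobSum σ n (norm V (U ⊓ d.inertia) (frobSum φ n yt)) := by
          rw [frobSum_mul, frobSum_eq_pow_of_smul_eq (hwU σ hσU)]
      _ = w ^ n * norm V (U ⊓ d.inertia) (frobSum σ n (frobSum φ n yt)) := by
          rw [map_frobSum (norm_one _ _) (norm_mul _ _) (fun j _ => hcommσ _ (fixedBy_antitone hle0 hz_fix) j)]
      _ = w ^ n * norm V (U ⊓ d.inertia) (frobSum φ n y) := by
          rw [frobSum_frobSum_comm ((Commute.refl φ).pow_left n) n n yt, hzz]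
      _ = w ^ n * norm S U y := by
          rw [d.norm_frobField_eq_norm_frobSum hU hV hVU hUn hσU hdegσ_pos hφU hφ hyS, hidx0]
  refine ⟨w ^ k * norm S V y, (d.unitGroup V).mul_mem
    ((d.unitGroup V).pow_mem (d.unitGroup_le_unitGroup hU hV hVU hw_unitU) k)
    (d.norm_mem_unitGroup hV hS hSV hy_unit), ?_⟩
  rw [norm_mul, norm_norm hSV hVU hyS, norm_eq_pow_of_mem ((fixedBy A U).pow_mem hwU k), hNu, ← pow_mul,
    mul_comm k, hn_def]

/-! ### The reciprocity map on Frobenius lifts (Neukirch (5.2)) -/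

/-- A chosen prime element `π_S` of the field `S` (`v_S(π_S) = 1`; junk value `1` if `S` has none).
[cite: NeukirchANT1999, Ch. IV §4, (4.8)] -/
def primeOf (S : Subgroup W) : A := by
  classical
  exact if h : ∃ π ∈ fixedBy A S, d.val S π = 1 then h.choose else 1

/-- `π_S ∈ A_S`. [folklore] -/
theorem primeOf_mem {S : Subgroup W} (hS : d.IsField S) : d.primeOf S ∈ fixedBy A S := by
  classical
  unfold primeOf
  rw [dif_pos (d.exists_val_eq_one hS)]
  exact (d.exists_val_eq_one hS).choose_spec.1

/-- `v_S(π_S) = 1`. [folklore] -/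
theorem val_primeOf {S : Subgroup W} (hS : d.IsField S) : d.val S (d.primeOf S) = 1 := by
  classical
  unfold primeOf
  rw [dif_pos (d.exists_val_eq_one hS)]
  exact (d.exists_val_eq_one hS).choose_spec.2

/-- **Neukirch's reciprocity map on Frobenius lifts** ((5.2)), as a representative in `A_K`:
`r̃_{L̃|K}(σ) = N_{Σ|K}(π_Σ)`, `Σ` the fixed field of `σ ∈ Frob(L̃|K)` (`σ ∈ G_K` of positive degree),
`π_Σ` a (chosen) prime of `Σ`; its class modulo `N_{L|K} A_L` (`normGroup V U`) is independent of the
choice (`IsClassFieldTheory.norm_frobField_div_recElt_mem`). Here `U = G_K ∩ W`, `V = G_L ∩ W`.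
[cite: NeukirchANT1999, Ch. IV §5, Def. (5.2)] -/
def recElt (U V : Subgroup W) (σ : W) : A := norm (d.frobField V σ) U (d.primeOf (d.frobField V σ))

/-- Conjugating a Frobenius field: `τ G_Σ τ⁻¹ = G_{Σ^τ}`, `Σ^τ` the fixed field of `τστ⁻¹`.
[cite: NeukirchANT1999, Ch. IV §5, proof of (5.5)] -/
theorem conjSub_frobField {V : Subgroup W} {τ : W} (hτ : τ ∈ Subgroup.normalizer (V : Set W)) (σ : W) :
    conjSub τ (d.frobField V σ) = d.frobField V (τ * σ * τ⁻¹) := by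
  have h1 : conjSub τ (V ⊓ d.inertia) = V ⊓ d.inertia :=
    conjSub_eq_self_of_mem_normalizer (d.mem_normalizer_inf_inertia hτ)
  unfold frobField
  rw [conjSub, Subgroup.map_sup, ← conjSub, ← conjSub, h1, conjSub, MonoidHom.map_zpowers]
  rfl

/-- The quotient of two primes of `L̃` — primes of Frobenius fields `Σ, Σ'` (both with `Σ̃ = L̃`) — is
a unit of `L̃`. [cite: NeukirchANT1999, Ch. IV §5, proof of (5.5)] -/
theorem isInfUnit_div_of_val_eq_one {V S S' : Subgroup W} (hS : d.IsField S) (hS' : d.IsField S')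
    (hle : V ⊓ d.inertia ≤ S) (hle' : V ⊓ d.inertia ≤ S') (hSI : S ⊓ d.inertia ≤ V ⊓ d.inertia)
    (hS'I : S' ⊓ d.inertia ≤ V ⊓ d.inertia) {π π' : A} (hπ : π ∈ fixedBy A S) (hvπ : d.val S π = 1)
    (hπ' : π' ∈ fixedBy A S') (hvπ' : d.val S' π' = 1) : d.IsInfUnit V (π / π') := by
  have hM := d.isField_inf hS hS'
  refine ⟨S ⊓ S', hM, le_inf hle hle', (d.mem_unitGroup_iff hM).mpr ⟨?_, ?_⟩⟩
  · exact (fixedBy A _).div_mem (fixedBy_antitone inf_le_left hπ) (fixedBy_antitone inf_le_right hπ')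
  · have h1 : d.val (S ⊓ S') π = 1 := by
      rw [d.val_eq_val_of_isUnramified hS hM inf_le_left (hSI.trans (le_inf hle hle')) hπ, hvπ]
    have h2 : d.val (S ⊓ S') π' = 1 := by
      rw [d.val_eq_val_of_isUnramified hS' hM inf_le_right (hS'I.trans (le_inf hle hle')) hπ', hvπ']
    rw [d.val_div hM (fixedBy_antitone inf_le_left hπ) (fixedBy_antitone inf_le_right hπ'), h1, h2, sub_self]

variable {d} in
/-- `1 ∈ U_{L̃}`. [folklore] -/
theorem IsInfUnit.one {V : Subgroup W} (hV : d.IsField V) : d.IsInfUnit V 1 :=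
  ⟨V, hV, inf_le_left, (d.unitGroup V).one_mem⟩

variable {d} in
/-- Finite products of units of `L̃` are units of `L̃`. [folklore] -/
theorem IsInfUnit.prod {V : Subgroup W} (hV : d.IsField V) {ι : Type*} {s : Finset ι} {f : ι → A}
    (h : ∀ i ∈ s, d.IsInfUnit V (f i)) : d.IsInfUnit V (∏ i ∈ s, f i) := by
  classical
  induction s using Finset.induction_on with
  | empty => simpa using IsInfUnit.one hV
  | insert a s ha ih =>
    rw [Finset.prod_insert ha]
    exact (h a (Finset.mem_insert_self a s)).mul (ih fun i hi => h i (Finset.mem_insert_of_mem hi))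

/-- Data of a prime of the Frobenius field of `σ ∈ G_K` (`deg σ ≠ 0`): membership and inertia facts
used repeatedly. [folklore] -/
theorem frobField_inf_inertia_le {V : Subgroup W} {σ : W} (hσ : σ ∈ Subgroup.normalizer (V : Set W))
    (hdeg : d.degZ σ ≠ 0) : d.frobField V σ ⊓ d.inertia ≤ V ⊓ d.inertia :=
  (d.frobField_inf_inertia hσ hdeg).le

variable {d} in
/-- **Independence of the prime** ((5.2), remark): for a unit `u` of `Σ`, `N_{Σ|K}(u) ∈ N_{L|K} A_L`
(apply (6.2) to the unramified extension `Σ·L | Σ`). [cite: NeukirchANT1999, Ch. IV §5, (5.2)] -/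
theorem IsClassFieldTheory.norm_frobField_unit_mem (hcf : d.IsClassFieldTheory) {U V : Subgroup W}
    (hV : d.IsField V) (hVU : V ≤ U) (hUn : U ≤ Subgroup.normalizer (V : Set W))
    {σ : W} (hσ : σ ∈ U) (hdeg : 0 < d.degZ σ) {u : A} (hu : u ∈ d.unitGroup (d.frobField V σ)) :
    norm (d.frobField V σ) U u ∈ normGroup V U := by
  haveI := d.finiteIndex hV
  have hσn := hUn hσ
  set S := d.frobField V σ
  have hS : d.IsField S := d.isField_frobField hV hσn hdeg
  haveI := d.finiteIndex hS
  have hT : d.IsField (S ⊓ V) := d.isField_inf hS hV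
  haveI := d.finiteIndex hT
  have hun : d.IsUnramified (S ⊓ V) S := by
    unfold IsUnramified
    rw [d.frobField_inf_inertia hσn hdeg.ne']
    exact le_inf (d.inf_inertia_le_frobField V σ) inf_le_left
  obtain ⟨ε, hε, hNε⟩ := hcf.exists_unit_norm_eq hS hT inf_le_left hun hu
  have hεT : ε ∈ fixedBy A (S ⊓ V) := d.unitGroup_le_fixedBy hT hε
  rw [← hNε, norm_norm inf_le_left (d.frobField_le hVU hσ) hεT,
    ← norm_norm inf_le_right hVU hεT]
  exact norm_mem_normGroup (norm_mem_fixedBy hεT)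

variable {d} in
/-- The class of `N_{Σ|K}(π)` modulo `N_{L|K} A_L` does not depend on the prime `π` of `Σ`.
[cite: NeukirchANT1999, Ch. IV §5, (5.2)] -/
theorem IsClassFieldTheory.norm_frobField_div_mem (hcf : d.IsClassFieldTheory) {U V : Subgroup W}
    (hV : d.IsField V) (hVU : V ≤ U) (hUn : U ≤ Subgroup.normalizer (V : Set W))
    {σ : W} (hσ : σ ∈ U) (hdeg : 0 < d.degZ σ) {π π' : A} (hπ : π ∈ fixedBy A (d.frobField V σ))
    (hvπ : d.val (d.frobField V σ) π = 1) (hπ' : π' ∈ fixedBy A (d.frobField V σ))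
    (hvπ' : d.val (d.frobField V σ) π' = 1) :
    norm (d.frobField V σ) U π / norm (d.frobField V σ) U π' ∈ normGroup V U := by
  have hS : d.IsField (d.frobField V σ) := d.isField_frobField hV (hUn hσ) hdeg
  haveI := d.finiteIndex hS
  rw [← norm_div]
  refine hcf.norm_frobField_unit_mem hV hVU hUn hσ hdeg ((d.mem_unitGroup_iff hS).mpr ⟨?_, ?_⟩)
  · exact (fixedBy A _).div_mem hπ hπ'
  · rw [d.val_div hS hπ hπ', hvπ, hvπ', sub_self]

/-- The number `d_K(σ) = deg σ / f_K` as a natural number. [folklore] -/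
theorem exists_degZ_eq_natMul {U : Subgroup W} (hU : d.IsField U) {σ : W} (hσ : σ ∈ U) (hdeg : 0 < d.degZ σ) :
    ∃ n : ℕ, 0 < n ∧ d.degZ σ = n * d.f U ∧ (d.frobField U σ).relIndex U = n := by
  obtain ⟨k, hk⟩ := d.f_dvd_degZ hU hσ
  have hf := d.f_pos hU
  have hkpos : 0 < k := by
    by_contra h
    have : d.degZ σ ≤ 0 := by rw [hk]; nlinarith
    linarith
  refine ⟨k.toNat, by omega, ?_, ?_⟩
  · rw [hk, Int.toNat_of_nonneg hkpos.le, mul_comm]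
  · have := d.relIndex_frobField_self hU hσ hdeg
    rw [hk, Int.mul_ediv_cancel_left _ (d.f_ne_zero hU)] at this
    have h2 : ((d.frobField U σ).relIndex U : ℤ) = (k.toNat : ℤ) := by
      rw [this, Int.toNat_of_nonneg hkpos.le]
    exact_mod_cast h2

/-! ### Multiplicativity (Neukirch (5.5)) -/

omit [MulDistribMulAction W A] in
/-- An identity in the abelian group `A` used in (5.5). [folklore] -/
theorem div_div_identity (P Q R T a b c : A) :
    P / c / (R / a * (T / b)) = P / T / (Q / b) * (Q / R / (c / a)) := by
  apply Additive.ofMul.injective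
  simp only [ofMul_div, ofMul_mul]
  abel

omit [MulDistribMulAction W A] in
/-- An identity in the abelian group `A` used in (5.5). [folklore] -/
theorem div_div_identity' (P₁ P₃ P₄ F₁ F₃ F₄ : A) :
    P₃ / (P₁ * P₄) / (F₃ / (F₁ * F₄)) = P₃ / F₃ / (P₁ / F₁ * (P₄ / F₄)) := by
  apply Additive.ofMul.injective
  simp only [ofMul_div, ofMul_mul]
  abel

/-- `φ^{n} • π = τ • π` for `τ = φⁿ σ⁻¹` and `π ∈ A_Σ` (`σ` fixes `π`). [folklore] -/
theorem pow_smul_eq_of_mem_fixedBy_frobField {V : Subgroup W} {σ φ : W} {n : ℕ} {π : A}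
    (hπ : π ∈ fixedBy A (d.frobField V σ)) : φ ^ n • π = (φ ^ n * σ⁻¹) • π := by
  have hσπ : σ • π = π := ((d.mem_fixedBy_frobField_iff).mp hπ).1
  rw [mul_smul, inv_smul_eq_iff.mpr hσπ.symm]

variable {d} in
/-- **Proposition (5.5)** (multiplicativity of the reciprocity map on Frobenius lifts):
`r̃(σ₁σ₂) ≡ r̃(σ₁) r̃(σ₂) mod N_{L|K} A_L` for `σ₁, σ₂ ∈ Frob(L̃|K)` (`∈ G_K` of positive degree).
Proof after Neukirch: with `d_K(φ) = 1`, `n_i = d_K(σ_i)`, `τ_i = φ^{n_i} σ_i⁻¹ ∈ G(L̃|K̃)` (left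
actions), `σ₄ = φ^{n₁} σ₂ φ^{-n₁}`, `Σ₄ = φ^{n₁} Σ₂`, `π₄ = φ^{n₁} π₂`: `τ₃ = τ₄ τ₁`,
`N_{Σ_i|K}(π_i) = N(π_i^{φ_{n_i}})` by (5.3), and `u = π₃^{φ_{n₃}} π₁^{-φ_{n₁}} π₄^{-φ_{n₄}}` satisfies
`u^{φ-1} = x^{τ₄-1} y^{τ₁-1}` with units `x = π₃^{τ₁}/π₄`, `y = π₃/π₁` of `L̃`, so (5.4) gives
`N(u) ∈ N_{L|K} A_L`. [cite: NeukirchANT1999, Ch. IV §5, Prop. (5.5)] -/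
theorem IsClassFieldTheory.recElt_mul_div_mem (hcf : d.IsClassFieldTheory) {U V : Subgroup W}
    (hU : d.IsField U) (hV : d.IsField V) (hVU : V ≤ U) (hUn : U ≤ Subgroup.normalizer (V : Set W))
    {σ₁ σ₂ : W} (h₁ : σ₁ ∈ U) (h₂ : σ₂ ∈ U) (hd₁ : 0 < d.degZ σ₁) (hd₂ : 0 < d.degZ σ₂) :
    d.recElt U V (σ₁ * σ₂) / (d.recElt U V σ₁ * d.recElt U V σ₂) ∈ normGroup V U := by
  classical
  haveI := d.finiteIndex hU
  haveI := d.finiteIndex hV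
  obtain ⟨φ, hφU, hφ⟩ := d.exists_frob hU
  have hf := d.f_pos hU
  -- degrees `n_i = d_K(σ_i)`
  obtain ⟨n₁, hn₁, hdeg₁, hidx₁⟩ := d.exists_degZ_eq_natMul hU h₁ hd₁
  obtain ⟨n₂, hn₂, hdeg₂, hidx₂⟩ := d.exists_degZ_eq_natMul hU h₂ hd₂
  set σ₃ := σ₁ * σ₂ with hσ₃_def
  have h₃ : σ₃ ∈ U := U.mul_mem h₁ h₂
  have hd₃ : 0 < d.degZ σ₃ := by rw [hσ₃_def, degZ_mul]; positivity
  obtain ⟨n₃, hn₃, hdeg₃, hidx₃⟩ := d.exists_degZ_eq_natMul hU h₃ hd₃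
  have hn₃eq : n₃ = n₁ + n₂ := by
    have : (n₃ : ℤ) * d.f U = (n₁ + n₂ : ℤ) * d.f U := by
      rw [← hdeg₃, hσ₃_def, degZ_mul, hdeg₁, hdeg₂]; ring
    exact_mod_cast mul_right_cancel₀ (d.f_ne_zero hU) this
  set c₁ := φ ^ n₁ with hc₁
  have hc₁U : c₁ ∈ U := U.pow_mem hφU n₁
  set σ₄ := c₁ * σ₂ * c₁⁻¹ with hσ₄_def
  have h₄ : σ₄ ∈ U := U.mul_mem (U.mul_mem hc₁U h₂) (U.inv_mem hc₁U)
  have hdegσ₄ : d.degZ σ₄ = d.degZ σ₂ := by rw [hσ₄_def, degZ_conj]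
  have hd₄ : 0 < d.degZ σ₄ := by rw [hdegσ₄]; exact hd₂
  obtain ⟨n₄, hn₄, hdeg₄, hidx₄⟩ := d.exists_degZ_eq_natMul hU h₄ hd₄
  have hn₄eq : n₄ = n₂ := by
    have : (n₄ : ℤ) * d.f U = (n₂ : ℤ) * d.f U := by rw [← hdeg₄, hdegσ₄, hdeg₂]
    exact_mod_cast mul_right_cancel₀ (d.f_ne_zero hU) this
  -- `τ_i = φ^{n_i} σ_i⁻¹ ∈ G(L̃|K̃)` and `τ₃ = τ₄ τ₁`
  set τ₁ := φ ^ n₁ * σ₁⁻¹ with hτ₁_def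
  set τ₃ := φ ^ n₃ * σ₃⁻¹ with hτ₃_def
  set τ₄ := φ ^ n₂ * σ₄⁻¹ with hτ₄_def
  have hτI : ∀ {σ : W} {n : ℕ}, σ ∈ U → d.degZ σ = n * d.f U → φ ^ n * σ⁻¹ ∈ U ⊓ d.inertia := by
    intro σ n hσ hdeg
    refine Subgroup.mem_inf.mpr ⟨U.mul_mem (U.pow_mem hφU n) (U.inv_mem hσ), ?_⟩
    rw [mem_inertia_iff, degZ_mul, degZ_inv, degZ_pow, hφ, hdeg]; ring
  have hτ₁ : τ₁ ∈ U ⊓ d.inertia := hτI h₁ hdeg₁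
  have hτ₃ : τ₃ ∈ U ⊓ d.inertia := hτI h₃ hdeg₃
  have hτ₄ : τ₄ ∈ U ⊓ d.inertia := hτI h₄ (by rw [hdeg₄, hn₄eq])
  have hτ : τ₃ = τ₄ * τ₁ := by
    rw [hτ₃_def, hτ₄_def, hτ₁_def, hσ₄_def, hσ₃_def, hn₃eq, hc₁]; group
  -- the Frobenius fields and their primes
  have hS : ∀ {σ : W}, σ ∈ U → 0 < d.degZ σ → d.IsField (d.frobField V σ) :=
    fun hσ hd => d.isField_frobField hV (hUn hσ) hd
  set a := d.primeOf (d.frobField V σ₁) with ha_def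
  set b₂ := d.primeOf (d.frobField V σ₂) with hb₂_def
  set c := d.primeOf (d.frobField V σ₃) with hc_def
  set b := c₁ • b₂ with hb_def
  have ha : a ∈ fixedBy A (d.frobField V σ₁) := d.primeOf_mem (hS h₁ hd₁)
  have hva : d.val (d.frobField V σ₁) a = 1 := d.val_primeOf (hS h₁ hd₁)
  have hb₂ : b₂ ∈ fixedBy A (d.frobField V σ₂) := d.primeOf_mem (hS h₂ hd₂)
  have hvb₂ : d.val (d.frobField V σ₂) b₂ = 1 := d.val_primeOf (hS h₂ hd₂)
  have hc : c ∈ fixedBy A (d.frobField V σ₃) := d.primeOf_mem (hS h₃ hd₃)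
  have hvc : d.val (d.frobField V σ₃) c = 1 := d.val_primeOf (hS h₃ hd₃)
  have hS₄eq : d.frobField V σ₄ = conjSub c₁ (d.frobField V σ₂) := by
    rw [hσ₄_def, d.conjSub_frobField (hUn hc₁U)]
  have hb : b ∈ fixedBy A (d.frobField V σ₄) := by
    rw [hS₄eq]; exact (smul_mem_fixedBy_conjSub_iff (σ := c₁)).mpr hb₂
  have hvb : d.val (d.frobField V σ₄) b = 1 := by
    rw [hS₄eq, hb_def, d.val_conjSub (hS h₂ hd₂) hb₂ c₁, hvb₂]
  -- `N_{Σ₄|K}(π₄) = N_{Σ₂|K}(π₂)`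
  have hNb : norm (d.frobField V σ₄) U b = d.recElt U V σ₂ := by
    haveI := d.finiteIndex (hS h₂ hd₂)
    have hb₂' : b₂ ∈ fixedBy A (d.frobField V σ₂ ⊓ U) := fixedBy_antitone inf_le_left hb₂
    have h := norm_conj' hb₂' c₁
    rw [conjSub_of_mem hc₁U, smul_norm_of_mem' hb₂' hc₁U] at h
    rw [hS₄eq]
    exact h
  -- (5.3): `N_{Σ_i|K}(π_i) = N(π_i^{φ_{n_i}})`
  have hN₁ : d.recElt U V σ₁ = norm V (U ⊓ d.inertia) (frobSum φ n₁ a) := by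
    rw [recElt, ← ha_def, d.norm_frobField_eq_norm_frobSum hU hV hVU hUn h₁ hd₁ hφU hφ ha, hidx₁]
  have hN₃ : d.recElt U V σ₃ = norm V (U ⊓ d.inertia) (frobSum φ n₃ c) := by
    rw [recElt, ← hc_def, d.norm_frobField_eq_norm_frobSum hU hV hVU hUn h₃ hd₃ hφU hφ hc, hidx₃]
  have hN₄ : d.recElt U V σ₂ = norm V (U ⊓ d.inertia) (frobSum φ n₂ b) := by
    rw [← hNb, d.norm_frobField_eq_norm_frobSum hU hV hVU hUn h₄ hd₄ hφU hφ hb, hidx₄, hn₄eq]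
  -- `u` and the relation `u^{φ-1} = x^{τ₄-1} y^{τ₁-1}`
  set u := frobSum φ n₃ c / (frobSum φ n₁ a * frobSum φ n₂ b) with hu_def
  set x := τ₁ • c / b with hx_def
  set y := c / a with hy_def
  have hrel : φ • u / u = τ₄ • x / x * (τ₁ • y / y) := by
    have e3 : φ ^ n₃ • c = (τ₄ * τ₁) • c := by rw [← hτ]; exact d.pow_smul_eq_of_mem_fixedBy_frobField hc
    have e1 : φ ^ n₁ • a = τ₁ • a := d.pow_smul_eq_of_mem_fixedBy_frobField ha
    have e4 : φ ^ n₂ • b = τ₄ • b := d.pow_smul_eq_of_mem_fixedBy_frobField hb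
    have hF3 : φ • frobSum φ n₃ c / frobSum φ n₃ c = τ₄ • (τ₁ • c) / c := by
      rw [smul_frobSum_div, e3, mul_smul]
    have hF1 : φ • frobSum φ n₁ a / frobSum φ n₁ a = τ₁ • a / a := by rw [smul_frobSum_div, e1]
    have hF4 : φ • frobSum φ n₂ b / frobSum φ n₂ b = τ₄ • b / b := by rw [smul_frobSum_div, e4]
    rw [hu_def, smul_div', smul_mul', div_div_identity', hF3, hF1, hF4, hx_def, hy_def, smul_div', smul_div']
    exact div_div_identity _ _ _ _ _ _ _
  -- the data are units of `L̃`
  have hle : ∀ {σ : W}, σ ∈ U → V ⊓ d.inertia ≤ d.frobField V σ := fun _ => d.inf_inertia_le_frobField V _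
  have hIl : ∀ {σ : W}, σ ∈ U → 0 < d.degZ σ → d.frobField V σ ⊓ d.inertia ≤ V ⊓ d.inertia :=
    fun hσ hd => d.frobField_inf_inertia_le (hUn hσ) hd.ne'
  have hy : d.IsInfUnit V y :=
    d.isInfUnit_div_of_val_eq_one (hS h₃ hd₃) (hS h₁ hd₁) (hle h₃) (hle h₁) (hIl h₃ hd₃) (hIl h₁ hd₁)
      hc hvc ha hva
  have hτ₁U : τ₁ ∈ U := (Subgroup.mem_inf.mp hτ₁).1
  have hτ₄U : τ₄ ∈ U := (Subgroup.mem_inf.mp hτ₄).1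
  -- conjugate primes: `ρ • π` is a prime of the Frobenius field of `ρσρ⁻¹`
  have hconj : ∀ {σ ρ : W} {π : A}, σ ∈ U → 0 < d.degZ σ → ρ ∈ U → π ∈ fixedBy A (d.frobField V σ) →
      d.val (d.frobField V σ) π = 1 →
      (ρ * σ * ρ⁻¹ ∈ U ∧ 0 < d.degZ (ρ * σ * ρ⁻¹) ∧ ρ • π ∈ fixedBy A (d.frobField V (ρ * σ * ρ⁻¹)) ∧
        d.val (d.frobField V (ρ * σ * ρ⁻¹)) (ρ • π) = 1) := by
    intro σ ρ π hσ hd hρ hπ hv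
    refine ⟨U.mul_mem (U.mul_mem hρ hσ) (U.inv_mem hρ), by rw [degZ_conj]; exact hd, ?_, ?_⟩
    · rw [← d.conjSub_frobField (hUn hρ)]; exact (smul_mem_fixedBy_conjSub_iff (σ := ρ)).mpr hπ
    · rw [← d.conjSub_frobField (hUn hρ), d.val_conjSub (hS hσ hd) hπ, hv]
  have hx : d.IsInfUnit V x := by
    obtain ⟨h1, h2, h3, h4⟩ := hconj h₃ hd₃ hτ₁U hc hvc
    exact d.isInfUnit_div_of_val_eq_one (hS h1 h2) (hS h₄ hd₄) (hle h1) (hle h₄) (hIl h1 h2) (hIl h₄ hd₄)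
      h3 h4 hb hvb
  have hu : d.IsInfUnit V u := by
    have hsplit : u = (∏ i ∈ Finset.range n₁, φ ^ i • y) *
        ∏ j ∈ Finset.range n₂, φ ^ j • (c₁ • c / b) := by
      rw [hu_def, hn₃eq, frobSum, Finset.prod_range_add, frobSum, frobSum, mul_div_mul_comm,
        ← Finset.prod_div_distrib, ← Finset.prod_div_distrib]
      have key : ∀ j : ℕ, φ ^ j • (c₁ • c / b) = φ ^ (n₁ + j) • c / φ ^ j • b := by
        intro j; rw [smul_div', smul_smul, hc₁, ← pow_add, add_comm]
      congr 1
      · refine Finset.prod_congr rfl (fun i _ => ?_)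
        rw [hy_def, smul_div']
      · exact Finset.prod_congr rfl (fun j _ => (key j).symm)
    rw [hsplit]
    refine (IsInfUnit.prod hV (fun i _ => hy.smul hUn (U.pow_mem hφU i))).mul
      (IsInfUnit.prod hV (fun j _ => IsInfUnit.smul hUn ?_ (U.pow_mem hφU j)))
    obtain ⟨k1, k2, k3, k4⟩ := hconj h₃ hd₃ hc₁U hc hvc
    exact d.isInfUnit_div_of_val_eq_one (hS k1 k2) (hS h₄ hd₄) (hle k1) (hle h₄) (hIl k1 k2) (hIl h₄ hd₄)
      k3 k4 hb hvb
  -- apply Lemma (5.4)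
  have hrel' : φ • u / u = ∏ i ∈ (Finset.univ : Finset (Fin 2)), (![τ₄, τ₁] i) • (![x, y] i) / (![x, y] i) := by
    rw [Fin.prod_univ_two]
    simpa using hrel
  obtain ⟨w, hw, hNw⟩ := hcf.exists_unit_norm_eq_norm_inertia hU hV hVU hUn hφU hφ hu
    (s := (Finset.univ : Finset (Fin 2))) (uu := ![x, y]) (τ := ![τ₄, τ₁])
    (by intro i _; fin_cases i <;> simpa) (by intro i _; fin_cases i <;> simpa) hrel'
  -- conclude: `N(u) = r̃(σ₃)/(r̃(σ₁) r̃(σ₂))`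
  have hNu : norm V (U ⊓ d.inertia) u = d.recElt U V σ₃ / (d.recElt U V σ₁ * d.recElt U V σ₂) := by
    rw [hu_def, norm_div, norm_mul, ← hN₁, ← hN₃, ← hN₄]
  rw [← hNu, ← hNw]
  exact norm_mem_normGroup (d.unitGroup_le_fixedBy hV hw)

/-! ### The reciprocity homomorphism `r_{L|K}` (Neukirch (5.6)) -/

/-- A chosen Frobenius `φ_K` of the field `U` (an element of `U` of degree `f_U`; junk `1` otherwise).
[cite: NeukirchANT1999, Ch. IV §4, (4.1)] -/
def frobOf (U : Subgroup W) : W := by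
  classical
  exact if h : ∃ φ ∈ U, d.degZ φ = d.f U then h.choose else 1

/-- `φ_K ∈ G_K`. [folklore] -/
theorem frobOf_mem {U : Subgroup W} (hU : d.IsField U) : d.frobOf U ∈ U := by
  classical
  unfold frobOf; rw [dif_pos (d.exists_frob hU)]; exact (d.exists_frob hU).choose_spec.1

/-- `deg φ_K = f_K`. [folklore] -/
theorem degZ_frobOf {U : Subgroup W} (hU : d.IsField U) : d.degZ (d.frobOf U) = d.f U := by
  classical
  unfold frobOf; rw [dif_pos (d.exists_frob hU)]; exact (d.exists_frob hU).choose_spec.2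

/-- A **Frobenius lift** of `τ ∈ G_K` to `Frob(L̃|K)` ((4.4)): `τ · φ_K^{[L:K]·m}` with `m` large,
an element of `τ G_L` of positive degree. [cite: NeukirchANT1999, Ch. IV §4, Prop. (4.4)] -/
def frobLift (U V : Subgroup W) (τ : W) : W :=
  τ * (d.frobOf U ^ V.relIndex U) ^ ((d.degZ τ).natAbs + 1)

/-- The Frobenius lift lies in `G_K`. [folklore] -/
theorem frobLift_mem {U V : Subgroup W} (hU : d.IsField U) {τ : W} (hτ : τ ∈ U) : d.frobLift U V τ ∈ U :=
  U.mul_mem hτ (U.pow_mem (U.pow_mem (d.frobOf_mem hU) _) _)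

/-- The Frobenius lift of `τ` lies in the coset `τ G_L`. [cite: NeukirchANT1999, Ch. IV §4, (4.4)] -/
theorem inv_mul_frobLift_mem {U V : Subgroup W} (hU : d.IsField U) (hV : d.IsField V) (hVU : V ≤ U)
    (hUn : U ≤ Subgroup.normalizer (V : Set W)) (τ : W) : τ⁻¹ * d.frobLift U V τ ∈ V := by
  haveI := d.finiteIndex hV
  unfold frobLift
  rw [inv_mul_cancel_left]
  exact V.pow_mem (pow_relIndex_mem hVU hUn (d.frobOf_mem hU)) _

/-- The Frobenius lift has positive degree. [cite: NeukirchANT1999, Ch. IV §4, (4.4)] -/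
theorem degZ_frobLift_pos {U V : Subgroup W} (hU : d.IsField U) (hV : d.IsField V) (τ : W) :
    0 < d.degZ (d.frobLift U V τ) := by
  haveI := d.finiteIndex hV
  unfold frobLift
  rw [degZ_mul, degZ_pow, degZ_pow, d.degZ_frobOf hU]
  have h1 : (1 : ℤ) ≤ (V.relIndex U : ℤ) * d.f U := by
    have : 0 < V.relIndex U := Nat.pos_of_ne_zero Subgroup.FiniteIndex.index_ne_zero
    have := d.f_pos hU
    have : (1 : ℤ) ≤ V.relIndex U := by exact_mod_cast ‹0 < V.relIndex U›
    nlinarith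
  have h2 : -d.degZ τ < ((d.degZ τ).natAbs + 1 : ℕ) := by
    push_cast
    linarith [neg_le_abs (d.degZ τ)]
  nlinarith

/-- **The reciprocity map `r_{L|K} : G(L|K) → A_K/N_{L|K}A_L`** ((5.6)), on representatives:
`τ ↦ r̃(σ̃) mod N_{L|K} A_L` for the Frobenius lift `σ̃` of `τ`; with values in `A ⧸ normGroup V U`
(the class lies in `A^U / N_{L|K} A_L`). Independence of the lift, multiplicativity and triviality
on `V` hold under the class field axiom (`IsClassFieldTheory.recMap_eq`, `IsClassFieldTheory.recMap_mul`, `recMap_eq_one_of_mem`).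
[cite: NeukirchANT1999, Ch. IV §5, Prop. (5.6)] -/
def recMap (U V : Subgroup W) (τ : W) : A ⧸ normGroup V U :=
  QuotientGroup.mk (d.recElt U V (d.frobLift U V τ))

/-- `r̃(σ) ∈ A_K`. [cite: NeukirchANT1999, Ch. IV §5, (5.2)] -/
theorem recElt_mem_fixedBy {U V : Subgroup W} (hV : d.IsField V) (hUn : U ≤ Subgroup.normalizer (V : Set W))
    {σ : W} (hσ : σ ∈ U) (hdeg : 0 < d.degZ σ) : d.recElt U V σ ∈ fixedBy A U := by
  have hS := d.isField_frobField hV (hUn hσ) hdeg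
  haveI := d.finiteIndex hS
  exact norm_mem_fixedBy (d.primeOf_mem hS)

/-- If `σ̃ ∈ G_L` then `r̃(σ̃) ∈ N_{L|K} A_L` ("the fixed field of `σ̃` contains `L`").
[cite: NeukirchANT1999, Ch. IV §5, proof of (5.6)] -/
theorem recElt_mem_normGroup_of_mem {U V : Subgroup W} (hV : d.IsField V) (hVU : V ≤ U)
    (hUn : U ≤ Subgroup.normalizer (V : Set W)) {σ : W} (hσV : σ ∈ V) (hdeg : 0 < d.degZ σ) :
    d.recElt U V σ ∈ normGroup V U := by
  have hS := d.isField_frobField hV (hUn (hVU hσV)) hdeg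
  haveI := d.finiteIndex hS
  haveI := d.finiteIndex hV
  have hπ := d.primeOf_mem hS
  unfold recElt
  rw [← norm_norm (d.frobField_le_of_mem hσV) hVU hπ]
  exact norm_mem_normGroup (norm_mem_fixedBy hπ)

/-- `Σ` only depends on `σ̃` modulo `G(L̃)`: `⟨σn⟩(V ∩ I) = ⟨σ⟩(V ∩ I)` for `n ∈ V ∩ I`. [folklore] -/
theorem frobField_mul_eq_of_mem {V : Subgroup W} {σ : W} (hσ : σ ∈ Subgroup.normalizer (V : Set W))
    {n : W} (hn : n ∈ V ⊓ d.inertia) : d.frobField V (σ * n) = d.frobField V σ := by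
  have hn' : n ∈ Subgroup.normalizer (V : Set W) := Subgroup.le_normalizer (Subgroup.mem_inf.mp hn).1
  have hσn : σ * n ∈ Subgroup.normalizer (V : Set W) := (Subgroup.normalizer (V : Set W)).mul_mem hσ hn'
  apply le_antisymm
  · refine sup_le ((Subgroup.zpowers_le).mpr ?_) le_sup_right
    rw [d.mem_frobField_iff hσ]
    exact ⟨1, by simpa using hn⟩
  · refine sup_le ((Subgroup.zpowers_le).mpr ?_) le_sup_right
    rw [d.mem_frobField_iff hσn]
    refine ⟨1, ?_⟩
    rw [zpow_one, mul_inv_rev, inv_mul_cancel_right]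
    exact (V ⊓ d.inertia).inv_mem hn

variable {d} in
/-- **(5.6), independence of the lift**: two Frobenius lifts of the same `τ ∈ G(L|K)` give the
same `r̃ mod N_{L|K} A_L`. [cite: NeukirchANT1999, Ch. IV §5, proof of (5.6)] -/
theorem IsClassFieldTheory.mk_recElt_eq (hcf : d.IsClassFieldTheory) {U V : Subgroup W}
    (hU : d.IsField U) (hV : d.IsField V) (hVU : V ≤ U) (hUn : U ≤ Subgroup.normalizer (V : Set W))
    {σ σ' : W} (hσ : σ ∈ U) (hσ' : σ' ∈ U) (hd : 0 < d.degZ σ) (hd' : 0 < d.degZ σ')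
    (h : σ⁻¹ * σ' ∈ V) :
    (QuotientGroup.mk (d.recElt U V σ) : A ⧸ normGroup V U) = QuotientGroup.mk (d.recElt U V σ') := by
  -- reduce to `deg σ ≤ deg σ'`
  wlog hle : d.degZ σ ≤ d.degZ σ' generalizing σ σ'
  · have h' : σ'⁻¹ * σ ∈ V := by simpa using V.inv_mem h
    exact (this hσ' hσ hd' hd h' (le_of_not_ge hle)).symm
  rcases hle.eq_or_lt with heq | hlt
  · -- equal degrees: `σ⁻¹σ' ∈ V ∩ I`, same Frobenius field
    have hn : σ⁻¹ * σ' ∈ V ⊓ d.inertia := by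
      refine Subgroup.mem_inf.mpr ⟨h, ?_⟩
      rw [mem_inertia_iff, degZ_mul, degZ_inv, heq]; ring
    have : σ' = σ * (σ⁻¹ * σ') := by group
    rw [this, recElt, recElt, d.frobField_mul_eq_of_mem (hUn hσ) hn]
  · -- `σ' = σ ρ` with `ρ ∈ V` of positive degree: multiplicativity and `r̃(ρ) ∈ N`
    set ρ := σ⁻¹ * σ' with hρ
    have hρU : ρ ∈ U := hVU h
    have hdρ : 0 < d.degZ ρ := by rw [hρ, degZ_mul, degZ_inv]; linarith
    have hσ'eq : σ' = σ * ρ := by rw [hρ]; group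
    rw [QuotientGroup.eq]
    have h1 := hcf.recElt_mul_div_mem hU hV hVU hUn hσ hρU hd hdρ
    rw [← hσ'eq] at h1
    have h2 := d.recElt_mem_normGroup_of_mem hV hVU hUn h hdρ
    -- `r(σ)⁻¹ r(σ') = (r(σ')/(r(σ) r(ρ))) · r(ρ)`
    have : (d.recElt U V σ)⁻¹ * d.recElt U V σ' =
        d.recElt U V σ' / (d.recElt U V σ * d.recElt U V ρ) * d.recElt U V ρ := by
      apply Additive.ofMul.injective
      simp only [ofMul_div, ofMul_mul, ofMul_inv]
      abel
    rw [this]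
    exact (normGroup V U).mul_mem h1 h2

variable {d} in
/-- **(5.6)**: `r_{L|K}(τ) = r̃(σ̃) mod N_{L|K} A_L` for *any* Frobenius lift `σ̃ ∈ τ G_L` of positive
degree. [cite: NeukirchANT1999, Ch. IV §5, Prop. (5.6)] -/
theorem IsClassFieldTheory.recMap_eq (hcf : d.IsClassFieldTheory) {U V : Subgroup W}
    (hU : d.IsField U) (hV : d.IsField V) (hVU : V ≤ U) (hUn : U ≤ Subgroup.normalizer (V : Set W))
    {τ σ : W} (hτ : τ ∈ U) (hσ : σ ∈ U) (hd : 0 < d.degZ σ) (h : τ⁻¹ * σ ∈ V) :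
    d.recMap U V τ = QuotientGroup.mk (d.recElt U V σ) := by
  unfold recMap
  apply hcf.mk_recElt_eq hU hV hVU hUn (d.frobLift_mem hU hτ) hσ (d.degZ_frobLift_pos hU hV τ) hd
  have h1 := d.inv_mul_frobLift_mem hU hV hVU hUn τ
  have : (d.frobLift U V τ)⁻¹ * σ = (τ⁻¹ * d.frobLift U V τ)⁻¹ * (τ⁻¹ * σ) := by group
  rw [this]
  exact V.mul_mem (V.inv_mem h1) h

variable {d} in
/-- `r_{L|K}` only depends on `τ` modulo `G_L`. [cite: NeukirchANT1999, Ch. IV §5, Prop. (5.6)] -/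
theorem IsClassFieldTheory.recMap_congr (hcf : d.IsClassFieldTheory) {U V : Subgroup W}
    (hU : d.IsField U) (hV : d.IsField V) (hVU : V ≤ U) (hUn : U ≤ Subgroup.normalizer (V : Set W))
    {τ τ' : W} (hτ : τ ∈ U) (hτ' : τ' ∈ U) (h : τ⁻¹ * τ' ∈ V) : d.recMap U V τ = d.recMap U V τ' := by
  rw [hcf.recMap_eq hU hV hVU hUn hτ (d.frobLift_mem hU hτ') (d.degZ_frobLift_pos hU hV τ') ?_]
  · rfl
  · have h1 := d.inv_mul_frobLift_mem hU hV hVU hUn τ'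
    have : τ⁻¹ * d.frobLift U V τ' = (τ⁻¹ * τ') * (τ'⁻¹ * d.frobLift U V τ') := by group
    rw [this]; exact V.mul_mem h h1

variable {d} in
/-- **`r_{L|K}` is a homomorphism** ((5.6), from (5.5)). [cite: NeukirchANT1999, Ch. IV §5, Prop. (5.6)] -/
theorem IsClassFieldTheory.recMap_mul (hcf : d.IsClassFieldTheory) {U V : Subgroup W}
    (hU : d.IsField U) (hV : d.IsField V) (hVU : V ≤ U) (hUn : U ≤ Subgroup.normalizer (V : Set W))
    {τ τ' : W} (hτ : τ ∈ U) (hτ' : τ' ∈ U) : d.recMap U V (τ * τ') = d.recMap U V τ * d.recMap U V τ' := by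
  set σ := d.frobLift U V τ
  set σ' := d.frobLift U V τ'
  have hσ := d.frobLift_mem (V := V) hU hτ
  have hσ' := d.frobLift_mem (V := V) hU hτ'
  have hd := d.degZ_frobLift_pos (V := V) hU hV τ
  have hd' := d.degZ_frobLift_pos (V := V) hU hV τ'
  -- `σσ'` is a Frobenius lift of `ττ'`
  have hlift : (τ * τ')⁻¹ * (σ * σ') ∈ V := by
    have h1 := d.inv_mul_frobLift_mem hU hV hVU hUn τ
    have h2 := d.inv_mul_frobLift_mem hU hV hVU hUn τ'
    have : (τ * τ')⁻¹ * (σ * σ') = τ'⁻¹ * (τ⁻¹ * σ) * τ' * (τ'⁻¹ * σ') := by group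
    rw [this]
    refine V.mul_mem ?_ h2
    exact (Subgroup.mem_normalizer_iff''.mp (hUn hτ') _).mp h1
  rw [hcf.recMap_eq hU hV hVU hUn (U.mul_mem hτ hτ') (U.mul_mem hσ hσ') (by rw [degZ_mul]; positivity) hlift]
  change _ = (QuotientGroup.mk (d.recElt U V σ) : A ⧸ normGroup V U) * QuotientGroup.mk (d.recElt U V σ')
  rw [← QuotientGroup.mk_mul, QuotientGroup.eq]
  have h := hcf.recElt_mul_div_mem hU hV hVU hUn hσ hσ' hd hd'
  have : (d.recElt U V (σ * σ'))⁻¹ * (d.recElt U V σ * d.recElt U V σ') =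
      (d.recElt U V (σ * σ') / (d.recElt U V σ * d.recElt U V σ'))⁻¹ := by
    rw [inv_div, div_eq_mul_inv, mul_comm]
  rw [this]
  exact (normGroup V U).inv_mem h

/-- `r_{L|K}` is trivial on `G_L`. [cite: NeukirchANT1999, Ch. IV §5, Prop. (5.6)] -/
theorem recMap_eq_one_of_mem {U V : Subgroup W}
    (hU : d.IsField U) (hV : d.IsField V) (hVU : V ≤ U) (hUn : U ≤ Subgroup.normalizer (V : Set W))
    {τ : W} (hτ : τ ∈ V) : d.recMap U V τ = 1 := by
  have hσV : d.frobLift U V τ ∈ V := by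
    have := d.inv_mul_frobLift_mem hU hV hVU hUn τ
    simpa using V.mul_mem hτ this
  unfold recMap
  rw [QuotientGroup.eq_one_iff]
  exact d.recElt_mem_normGroup_of_mem hV hVU hUn hσV (d.degZ_frobLift_pos hU hV τ)

/-- The values of `r_{L|K}` lie in `A_K / N_{L|K} A_L`. [cite: NeukirchANT1999, Ch. IV §5, (5.6)] -/
theorem recMap_mem_range {U V : Subgroup W} (hU : d.IsField U) (hV : d.IsField V)
    (hUn : U ≤ Subgroup.normalizer (V : Set W)) {τ : W} (hτ : τ ∈ U) :
    ∃ a ∈ fixedBy A U, d.recMap U V τ = QuotientGroup.mk a :=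
  ⟨_, d.recElt_mem_fixedBy hV hUn (d.frobLift_mem hU hτ) (d.degZ_frobLift_pos hU hV τ), rfl⟩


/-! ### The unramified case (Neukirch (5.7)) -/

/-- In an unramified pair `V ∩ I = U ∩ I`. [folklore] -/
theorem inf_inertia_eq_of_isUnramified {U V : Subgroup W} (hVU : V ≤ U) (hun : d.IsUnramified V U) :
    V ⊓ d.inertia = U ⊓ d.inertia :=
  le_antisymm (inf_le_inf_right _ hVU) (le_inf hun inf_le_right)

/-- `v_K(N_{L|K} A_L) ⊆ (L:K)·ℤ` for an unramified pair. [cite: NeukirchANT1999, Ch. IV §5, (5.7)] -/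
theorem dvd_val_of_mem_normGroup {U V : Subgroup W} (hU : d.IsField U) (hV : d.IsField V) (hVU : V ≤ U)
    (hun : d.IsUnramified V U) {x : A} (hx : x ∈ normGroup V U) : (V.relIndex U : ℤ) ∣ d.val U x := by
  haveI := d.finiteIndex hV
  obtain ⟨b, hb, rfl⟩ := mem_normGroup_iff.mp hx
  rw [d.val_norm hU hV hVU hb, d.relIndex_of_isUnramified hU hV hVU hun]
  obtain ⟨m, hm⟩ := d.f_dvd_f hU hV hVU
  rw [hm, Nat.mul_div_cancel_left _ (d.f_pos hU)]
  push_cast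
  rw [Int.mul_ediv_cancel_left _ (d.f_ne_zero hU)]
  exact Dvd.intro _ rfl

variable {d} in
/-- **(5.7), value on the Frobenius**: for `L|K` unramified, `r_{L|K}(φ_K) = π_K mod N_{L|K} A_L` for any
Frobenius `φ_K` and any prime `π_K` of `K`. [cite: NeukirchANT1999, Ch. IV §5, Prop. (5.7)] -/
theorem IsClassFieldTheory.recMap_frob_eq (hcf : d.IsClassFieldTheory) {U V : Subgroup W}
    (hU : d.IsField U) (hV : d.IsField V) (hVU : V ≤ U) (hun : d.IsUnramified V U)
    {φ : W} (hφU : φ ∈ U) (hφ : d.degZ φ = d.f U) {π : A} (hπ : π ∈ fixedBy A U) (hvπ : d.val U π = 1) :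
    d.recMap U V φ = QuotientGroup.mk π := by
  have hUn := d.le_normalizer_of_isUnramified hV hVU hun
  have hdeg : 0 < d.degZ φ := by rw [hφ]; exact_mod_cast d.f_pos hU
  rw [hcf.recMap_eq hU hV hVU hUn hφU hφU hdeg (by simp [V.one_mem]), QuotientGroup.eq]
  have hS : d.frobField V φ = U := by
    unfold frobField
    rw [d.inf_inertia_eq_of_isUnramified hVU hun]
    exact d.frobField_self hU hφU hφ
  have hSF := d.isField_frobField hV (hUn hφU) hdeg
  have h1 := hcf.norm_frobField_div_mem hV hVU hUn hφU hdeg (π := π) (π' := d.primeOf (d.frobField V φ))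
    (by rw [hS]; exact hπ) (by rw [hS]; exact hvπ) (d.primeOf_mem hSF) (d.val_primeOf hSF)
  rw [recElt]
  have h2 : ∀ x : A, x ∈ fixedBy A U → norm (d.frobField V φ) U x = x := by
    intro x hx; rw [hS]; exact norm_eq_self_of_le le_rfl hx
  rw [h2 π hπ, h2 _ (hS ▸ d.primeOf_mem hSF)] at h1
  rw [h2 _ (hS ▸ d.primeOf_mem hSF)]
  have : (d.primeOf (d.frobField V φ))⁻¹ * π = π / d.primeOf (d.frobField V φ) := by
    rw [div_eq_mul_inv, mul_comm]
  rw [this]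
  exact h1

variable {d} in
/-- **(5.7), injectivity**: for `L|K` unramified, `r_{L|K}(τ) = 1 ⟹ τ ∈ G_L`.
[cite: NeukirchANT1999, Ch. IV §5, Prop. (5.7)] -/
theorem IsClassFieldTheory.mem_of_recMap_eq_one_of_isUnramified (hcf : d.IsClassFieldTheory) {U V : Subgroup W}
    (hU : d.IsField U) (hV : d.IsField V) (hVU : V ≤ U) (hun : d.IsUnramified V U)
    {τ : W} (hτ : τ ∈ U) (h1 : d.recMap U V τ = 1) : τ ∈ V := by
  haveI := d.finiteIndex hV
  have hUn := d.le_normalizer_of_isUnramified hV hVU hun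
  obtain ⟨φ, hφU, hφ⟩ := d.exists_frob hU
  obtain ⟨π, hπ, hvπ⟩ := d.exists_val_eq_one hU
  obtain ⟨k, hk⟩ := d.exists_zpow_inv_mul_mem_of_isUnramified hU hun hφU hφ hτ
  -- `τ ≡ φ^k`, `r(φ^k) = π^k`, so `π^k ∈ N_{L|K} A_L`, `n ∣ k`
  have hrk : d.recMap U V τ = QuotientGroup.mk (π ^ k) := by
    rw [← hcf.recMap_congr hU hV hVU hUn (U.zpow_mem hφU k) hτ hk]
    -- `recMap` is a homomorphism on `U`: compute on powers
    have hpow : ∀ m : ℕ, d.recMap U V (φ ^ m) = QuotientGroup.mk (π ^ m) := by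
      intro m
      induction m with
      | zero => simp [recMap_eq_one_of_mem (d := d) hU hV hVU hUn V.one_mem]
      | succ m ih =>
        rw [pow_succ, hcf.recMap_mul hU hV hVU hUn (U.pow_mem hφU m) hφU, ih,
          hcf.recMap_frob_eq hU hV hVU hun hφU hφ hπ hvπ, pow_succ, QuotientGroup.mk_mul]
    cases k with
    | ofNat m => rw [Int.ofNat_eq_natCast, zpow_natCast, zpow_natCast, hpow]
    | negSucc m =>
      have hinv : d.recMap U V ((φ ^ (m + 1))⁻¹) = (d.recMap U V (φ ^ (m + 1)))⁻¹ := by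
        rw [eq_inv_iff_mul_eq_one, ← hcf.recMap_mul hU hV hVU hUn (U.inv_mem (U.pow_mem hφU _))
          (U.pow_mem hφU _), inv_mul_cancel]
        exact recMap_eq_one_of_mem (d := d) hU hV hVU hUn V.one_mem
      rw [zpow_negSucc, zpow_negSucc, hinv, hpow, QuotientGroup.mk_inv]
  rw [hrk, QuotientGroup.eq_one_iff] at h1
  have hdvd := d.dvd_val_of_mem_normGroup hU hV hVU hun h1
  rw [d.val_zpow hU hπ, hvπ, mul_one] at hdvd
  -- `n ∣ k ⟹ φ^k ∈ V`
  have hφk : φ ^ k ∈ V := by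
    rw [d.mem_iff_of_isUnramified hV hVU hun (U.zpow_mem hφU k), degZ_zpow, hφ]
    rw [d.relIndex_of_isUnramified hU hV hVU hun] at hdvd
    obtain ⟨m, hm⟩ := d.f_dvd_f hU hV hVU
    rw [hm, Nat.mul_div_cancel_left _ (d.f_pos hU)] at hdvd
    rw [hm]; push_cast
    rw [mul_comm (d.f U : ℤ)]
    exact mul_dvd_mul hdvd dvd_rfl
  simpa using V.mul_mem hφk hk

variable {d} in
/-- **(5.7), surjectivity**: for `L|K` unramified every class of `A_K/N_{L|K}A_L` is an `r_{L|K}(τ)`.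
[cite: NeukirchANT1999, Ch. IV §5, Prop. (5.7)] -/
theorem IsClassFieldTheory.exists_recMap_eq_of_isUnramified (hcf : d.IsClassFieldTheory) {U V : Subgroup W}
    (hU : d.IsField U) (hV : d.IsField V) (hVU : V ≤ U) (hun : d.IsUnramified V U)
    {a : A} (ha : a ∈ fixedBy A U) : ∃ τ ∈ U, d.recMap U V τ = QuotientGroup.mk a := by
  haveI := d.finiteIndex hV
  have hUn := d.le_normalizer_of_isUnramified hV hVU hun
  obtain ⟨φ, hφU, hφ⟩ := d.exists_frob hU
  obtain ⟨π, hπ, hvπ⟩ := d.exists_val_eq_one hU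
  set k := d.val U a with hk
  obtain ⟨u, hu, hau⟩ := d.exists_unit_mul_zpow hU hπ hvπ ha
  rw [← hk] at hau
  obtain ⟨ε, hε, hNε⟩ := hcf.exists_unit_norm_eq hU hV hVU hun hu
  refine ⟨φ ^ k, U.zpow_mem hφU _, ?_⟩
  have hpow : ∀ m : ℕ, d.recMap U V (φ ^ m) = QuotientGroup.mk (π ^ m) := by
    intro m
    induction m with
    | zero => simp [recMap_eq_one_of_mem (d := d) hU hV hVU hUn V.one_mem]
    | succ m ih =>
      rw [pow_succ, hcf.recMap_mul hU hV hVU hUn (U.pow_mem hφU m) hφU, ih,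
        hcf.recMap_frob_eq hU hV hVU hun hφU hφ hπ hvπ, pow_succ, QuotientGroup.mk_mul]
  have hzpow : ∀ k : ℤ, d.recMap U V (φ ^ k) = QuotientGroup.mk (π ^ k) := by
    intro k
    cases k with
    | ofNat m => rw [Int.ofNat_eq_natCast, zpow_natCast, zpow_natCast, hpow]
    | negSucc m =>
      have hinv : d.recMap U V ((φ ^ (m + 1))⁻¹) = (d.recMap U V (φ ^ (m + 1)))⁻¹ := by
        rw [eq_inv_iff_mul_eq_one, ← hcf.recMap_mul hU hV hVU hUn (U.inv_mem (U.pow_mem hφU _))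
          (U.pow_mem hφU _), inv_mul_cancel]
        exact recMap_eq_one_of_mem (d := d) hU hV hVU hUn V.one_mem
      rw [zpow_negSucc, zpow_negSucc, hinv, hpow, QuotientGroup.mk_inv]
  rw [hzpow, QuotientGroup.eq, hau, ← hNε]
  have : (π ^ k)⁻¹ * (norm V U ε * π ^ k) = norm V U ε := by
    rw [mul_comm (norm V U ε), ← mul_assoc, inv_mul_cancel, one_mul]
  rw [this]
  exact norm_mem_normGroup (d.unitGroup_le_fixedBy hV hε)

/-! ### Functoriality in the fields (Neukirch (5.8), left diagram) -/

variable {d} in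
/-- **(5.8), left diagram** (norm functoriality): for Galois `L|K`, `L'|K'` with `K ⊆ K'`, `L ⊆ L'`
(`U' ≤ U`, `V' ≤ V`) and `τ ∈ G(L'|K')`: `r_{L|K}(τ|_L) = N_{K'|K}(r_{L'|K'}(τ)) mod N_{L|K} A_L` —
with `σ'` any Frobenius lift of `τ` for `L'|K'`, `r_{L|K}(τ) ≡ N_{K'|K}(r̃_{L̃'|K'}(σ'))`.  (A Frobenius
lift for `L'|K'` is one for `L|K`; `Σ = Σ' ∩ L̃` and `N_{Σ'|Σ}` of a prime of `Σ'` is a prime of `Σ`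
as `f_{Σ'|Σ} = 1`.) [cite: NeukirchANT1999, Ch. IV §5, Prop. (5.8)] -/
theorem IsClassFieldTheory.recMap_eq_mk_norm_recElt (hcf : d.IsClassFieldTheory) {U V U' V' : Subgroup W}
    (hU : d.IsField U) (hV : d.IsField V) (hVU : V ≤ U) (hUn : U ≤ Subgroup.normalizer (V : Set W))
    (hU' : d.IsField U') (hV' : d.IsField V') (hV'U' : V' ≤ U') (hU'n : U' ≤ Subgroup.normalizer (V' : Set W))
    (hU'U : U' ≤ U) (hV'V : V' ≤ V) {τ σ' : W} (hτ : τ ∈ U') (hσ' : σ' ∈ U') (hd : 0 < d.degZ σ')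
    (hlift : τ⁻¹ * σ' ∈ V') :
    d.recMap U V τ = QuotientGroup.mk (norm U' U (d.recElt U' V' σ')) := by
  haveI := d.finiteIndex hU'
  have hσ : σ' ∈ U := hU'U hσ'
  rw [hcf.recMap_eq hU hV hVU hUn (hU'U hτ) hσ hd (hV'V hlift)]
  -- the two Frobenius fields `Σ' ≤ Σ`
  set S := d.frobField V σ' with hS_def
  set S' := d.frobField V' σ' with hS'_def
  have hS : d.IsField S := d.isField_frobField hV (hUn hσ) hd
  have hS' : d.IsField S' := d.isField_frobField hV' (hU'n hσ') hd
  haveI := d.finiteIndex hS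
  haveI := d.finiteIndex hS'
  have hS'S : S' ≤ S := d.frobField_mono hV'V σ'
  have hSU : S ≤ U := d.frobField_le hVU hσ
  have hS'U' : S' ≤ U' := d.frobField_le hV'U' hσ'
  -- `f_Σ = f_Σ' = deg σ'`, so the norm of a prime of `Σ'` is a prime of `Σ`
  have hfS : (d.f S : ℤ) = d.degZ σ' := d.f_frobField hV (hUn hσ) hd
  have hfS' : (d.f S' : ℤ) = d.degZ σ' := d.f_frobField hV' (hU'n hσ') hd
  set π' := d.primeOf S' with hπ'_def
  have hπ' := d.primeOf_mem hS'
  have hvπ' := d.val_primeOf hS'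
  have hπ : norm S' S π' ∈ fixedBy A S := norm_mem_fixedBy hπ'
  have hvπ : d.val S (norm S' S π') = 1 := by
    rw [d.val_norm hS hS' hS'S hπ', hvπ', mul_one]
    have : (d.f S' : ℤ) = d.f S := by rw [hfS, hfS']
    rw [this]
    exact Int.ediv_self (d.f_ne_zero hS)
  -- compare with the chosen prime of `Σ`
  have h1 := hcf.norm_frobField_div_mem hV hVU hUn hσ hd hπ hvπ (d.primeOf_mem hS) (d.val_primeOf hS)
  rw [QuotientGroup.eq, recElt, recElt, ← hS_def, ← hS'_def, ← hπ'_def]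
  rw [norm_norm hS'S hSU hπ', ← norm_norm hS'U' hU'U hπ'] at h1
  have : (norm S U (d.primeOf S))⁻¹ * norm U' U (norm S' U' π') =
      (norm U' U (norm S' U' π') / norm S U (d.primeOf S)) := by rw [div_eq_mul_inv, mul_comm]
  rw [this]
  exact h1

variable {d} in
/-- (5.8) for the restriction `G(L'|K) → G(L|K)` (`K' = K`): `r_{L|K}(τ) = r̃_{L̃'|K}(σ') mod N_{L|K}A_L`
for a Frobenius lift `σ'` of `τ` w.r.t. `L'`. [cite: NeukirchANT1999, Ch. IV §5, Prop. (5.8)] -/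
theorem IsClassFieldTheory.recMap_eq_mk_recElt_of_le (hcf : d.IsClassFieldTheory) {U V V' : Subgroup W}
    (hU : d.IsField U) (hV : d.IsField V) (hVU : V ≤ U) (hUn : U ≤ Subgroup.normalizer (V : Set W))
    (hV' : d.IsField V') (hV'U : V' ≤ U) (hUn' : U ≤ Subgroup.normalizer (V' : Set W))
    (hV'V : V' ≤ V) {τ σ' : W} (hτ : τ ∈ U) (hσ' : σ' ∈ U) (hd : 0 < d.degZ σ')
    (hlift : τ⁻¹ * σ' ∈ V') :
    d.recMap U V τ = QuotientGroup.mk (d.recElt U V' σ') := by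
  have h := hcf.recMap_eq_mk_norm_recElt hU hV hVU hUn hU hV' hV'U hUn' le_rfl hV'V hτ hσ' hd hlift
  rw [h, norm_eq_self_of_le le_rfl (d.recElt_mem_fixedBy hV' hUn' hσ' hd)]

variable {d} in
/-- (5.8), `K' = K`: `r_{L|K}(τ) = r_{L'|K}(τ) mod N_{L|K} A_L` (compatibility with
`A_K/N_{L'|K} → A_K/N_{L|K}`). [cite: NeukirchANT1999, Ch. IV §5, Prop. (5.8)] -/
theorem IsClassFieldTheory.recMap_eq_map_recMap (hcf : d.IsClassFieldTheory) {U V V' : Subgroup W}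
    (hU : d.IsField U) (hV : d.IsField V) (hVU : V ≤ U) (hUn : U ≤ Subgroup.normalizer (V : Set W))
    (hV' : d.IsField V') (hV'U : V' ≤ U) (hUn' : U ≤ Subgroup.normalizer (V' : Set W))
    (hV'V : V' ≤ V) {τ : W} (hτ : τ ∈ U) :
    d.recMap U V τ = QuotientGroup.map (normGroup V' U) (normGroup V U) (MonoidHom.id A)
      (by
        haveI := d.finiteIndex hV; haveI := d.finiteIndex hV'
        simpa using normGroup_le_normGroup (A := A) hV'V hVU) (d.recMap U V' τ) := by
  rw [hcf.recMap_eq_mk_recElt_of_le hU hV hVU hUn hV' hV'U hUn' hV'V hτ (d.frobLift_mem hU hτ)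
    (d.degZ_frobLift_pos hU hV' τ) (d.inv_mul_frobLift_mem hU hV' hV'U hUn' τ)]
  rfl

end WeilDatum

end AbstractCFT

end Literature.NumberTheory.GaloisRepresentations

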